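import Mathlib.RingTheory.SimpleRing.Principal
import Literature.NumberTheory.EllipticCurves.ZpExtensionProPDescent
import Literature.AnabelianGeometry.EtaleTheta.RootsOfUnityPadicOrders
import Literature.NumberTheory.EllipticCurves.Serre1967.PotentiallySupersingularNoStableLineProofs
import Literature.NumberTheory.EllipticCurves.CyclotomicTowerLocalInertiaFiniteIndexProofs
import Literature.NumberTheory.EllipticCurves.OrdinaryReductionFrobeniusHomProofs
import Literature.NumberTheory.EllipticCurves.OrdinaryLocalReductionMapProofs
import Literature.NumberTheory.EllipticCurves.IwasawaTowerTorsionPotGoodLocal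
import HarnessLib

/-!
# Imai 1975: the `p`-power torsion of an elliptic curve with potentially good reduction is finite over the local cyclotomic `ℤ_p`-tower — `imai1975_finite_fixedPoints_kerSubgroup_inf_decomp_of_padicValRat_j_nonneg` HOLDS (re-homed proofs)

**Imai 1975 / Serre: finiteness of the `p`-power torsion of an elliptic curve over the local cyclotomic tower — the named fact
`Literature.NumberTheory.EllipticCurves.imai1975_finite_fixedPoints_kerSubgroup_inf_decomp_of_padicValRat_j_nonneg` (`IwasawaTowerTorsionPotGoodLocal.lean`: for `W/ℚ` with `v_p(j) ≥ 0`
(potentially good reduction at `p`) the fixed points of `D_𝔭 ⊓ ker κ` on `W(K̄)[p^∞]` are finite along the cyclotomic `ℤ_p`-extension) HOLDS — EXACT name `…_holds`**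
([Imai1975] H. Imai, *A remark on the rational points of abelian varieties with values in cyclotomic `ℤ_p`-extensions*, Proc. Japan Acad. **51** (1975), Theorem;
[Serre1967GroupesPDivisibles]; [GreenbergLNM1716] §1 p. 62; [SilvermanAEC2009] VII.5.4–5.5).  Contents: the layer subgroups of a `ℤ_p`-extension and pro-`p` descent,
torsion counts, the local tower moves a `p`-torsion point when `μ_p ⊄ K_𝔭`, finiteness from "no stable divisible line", the ordinary bricks (Frobenius eigenparts, the
unit-root line), the ordinary local case, the inversion element, and the discharge (potentially good = potentially ordinary or potentially supersingular).
RE-HOMED into `Literature/` by the Hodge foundations lane (`lit-hodgefound`, seat p20, generation 40): verbatim DECLARATION-LEVEL ports (the 35 declarations needed, in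
dependency order; each Part is a slice of one Summits module) of 12 theorem modules `Summits/BirchSwinnertonDyer/BirchSwinnertonDyer/Theorems/{KatoDescentPotSupersingularTowerTorsion*,
LocalTower*,KolyvaginFrobeniusEigenparts,SchneiderFreeAdditiveX3LocalTowerTorsionLine*}.lean` and `Summits/BirchSwinnertonDyer/Rank1Residual/X11b/{AnticyclotomicLocalTowerTorsion,CoinvariantsDescent}.lean`;
namespaces re-rooted at `Literature.NumberTheory.EllipticCurves.IwasawaTowerTorsion` (`TowerTorsionFinite(Ordinary)` ↦ `.Finite(Ordinary)`, the layer-subgroup / torsion-count / coinvariant lemmas ↦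
`.LayerSubgroups` / `.TorsionCount` / `.Coinvariants`, the two declarations the source places in Mathlib's `WeierstrassCurve` namespace ↦ `.WeierstrassCurve`, their
dot-notation call sites becoming applications); the Summits-side predicate `LocalTowerTorsionFiniteAt E p κ 𝔭` is spelled out by its body (finiteness of the fixed
points of `decomp 𝔭 ⊓ κ.kerSubgroup` on `E.geomPrimaryTorsion p`); `ZpExtension.isClosed_decomp` of the tree is used, not re-declared.  Theorem-only: no definition, no new
named fact (D-0026); imports Mathlib/Literature only; every declaration carries the citation of the printed statement it formalises or serves.  The Summits originals
stay in place (transitional duplication).  WHAT THIS IS NOT: nothing here bears on BSD; it is Imai's finiteness theorem in the tree's vocabulary.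
-/

noncomputable section

/-!
## Part 1 — port of `Summits/BirchSwinnertonDyer/BirchSwinnertonDyer/Theorems/KatoDescentPotSupersingularTowerTorsionOrdinaryBricks.lean` (3 declarations kept)

# Bricks for Imai's finiteness on the potentially ordinary rows: Frobenius-power fixed points, divisible subgroups with finite image, and Weil-pairing annihilators

Declarations of this Part (verbatim port; each keeps its own docstring and citation): `finite_setOf_frobenius_pow_smul_eq`, `le_ker_of_divisible_of_finite_map`, `smul_sub_mem_zmultiples_of_fixing_rootsOfUnity`.

Reference keys (see `references.bib` and the declarations' citations): [SilvermanAEC2009].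
-/

section Part1

open scoped _root_.Classical _root_.NumberField AddSubgroup
open _root_.Function _root_.Field _root_.NumberField _root_.IsDedekindDomain _root_.WeierstrassCurve
open Literature.NumberTheory.EllipticCurves
open Literature.NumberTheory.GaloisRepresentations

universe u

namespace Literature.NumberTheory.EllipticCurves.IwasawaTowerTorsion.FiniteOrdinary

/-! ## §1 Only finitely many points of `Ẽ(k̄)` are fixed by a power of the Frobenius -/

/-- For a finite field `k` with `q` elements, `σ` the `q`-power Frobenius of `k̄` and `e ≥ 1`, only finitely many
geometric points of a Weierstrass curve `V/k` are fixed by `σ^e` (their coordinates are roots of `X^{q^e} - X`).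
[cite: SilvermanAEC2009, V.§1 (proof of Thm. V.1.1)] -/
theorem finite_setOf_frobenius_pow_smul_eq {k : Type u} [Field k] [Finite k] (V : WeierstrassCurve k)
    {σ : absoluteGaloisGroup k} (hσ : ∀ x : AlgebraicClosure k, σ • x = x ^ Nat.card k)
    {e : ℕ} (he : 1 ≤ e) : {P : V.geomPoints | σ ^ e • P = P}.Finite := by
  have hq : 1 < Nat.card k := Finite.one_lt_card
  set Q : ℕ := Nat.card k ^ e with hQdef
  have hQ : 1 < Q := Nat.one_lt_pow (by omega) hq
  have hσe : ∀ (n : ℕ) (x : AlgebraicClosure k), σ ^ n • x = x ^ Nat.card k ^ n := by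
    intro n
    induction n with
    | zero => intro x; rw [pow_zero, one_smul, pow_zero, pow_one]
    | succ n ih => intro x; rw [pow_succ, mul_smul, hσ, smul_pow', ih, ← pow_mul, ← pow_succ]
  -- the roots of `X^Q - X`
  set R : Set (AlgebraicClosure k) := {x | x ^ Q = x} with hRdef
  have hR : R.Finite := by
    have hf0 : (Polynomial.X ^ Q - Polynomial.X : Polynomial (AlgebraicClosure k)) ≠ 0 :=
      FiniteField.X_pow_card_sub_X_ne_zero (AlgebraicClosure k) hQ
    refine ((Polynomial.X ^ Q - Polynomial.X : Polynomial (AlgebraicClosure k)).roots.toFinset.finite_toSet).subset ?_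
    intro x hx
    rw [hRdef, Set.mem_setOf_eq] at hx
    rw [Finset.mem_coe, Multiset.mem_toFinset, Polynomial.mem_roots hf0, Polynomial.IsRoot.def,
      Polynomial.eval_sub, Polynomial.eval_pow, Polynomial.eval_X, hx, sub_self]
  -- coordinates
  let g : V.geomPoints → Option (AlgebraicClosure k × AlgebraicClosure k) := fun P ↦
    match (P : (V.baseChange (AlgebraicClosure k)).toAffine.Point) with
    | .zero => none
    | .some x y _ => some (x, y)
  have hg : Function.Injective g := by
    intro P P' hPQ
    change (V.baseChange (AlgebraicClosure k)).toAffine.Point at P P'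
    rcases P with _ | ⟨x, y, h⟩ <;> rcases P' with _ | ⟨x', y', h'⟩
    · rfl
    · exact (Option.some_ne_none _ hPQ.symm).elim
    · exact (Option.some_ne_none _ hPQ).elim
    · simp only [g, Option.some.injEq, Prod.mk.injEq] at hPQ
      obtain ⟨rfl, rfl⟩ := hPQ
      rfl
  have hT : (insert none ((fun xy : AlgebraicClosure k × AlgebraicClosure k ↦ some xy) '' (R ×ˢ R))).Finite :=
    ((hR.prod hR).image _).insert none
  refine (hT.preimage hg.injOn).subset ?_
  intro P hP
  rw [Set.mem_setOf_eq] at hP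
  rw [Set.mem_preimage]
  change (V.baseChange (AlgebraicClosure k)).toAffine.Point at P
  rcases P with _ | ⟨x, y, h⟩
  · exact Set.mem_insert _ _
  · refine Set.mem_insert_of_mem _ ⟨(x, y), ?_, rfl⟩
    have hmap : Affine.Point.map
        ((show AlgebraicClosure k ≃ₐ[k] AlgebraicClosure k from σ ^ e) :
          AlgebraicClosure k →ₐ[k] AlgebraicClosure k) (.some x y h) = .some x y h := hP
    rw [Affine.Point.map_some] at hmap
    simp only [Affine.Point.some.injEq] at hmap
    obtain ⟨hx, hy⟩ := hmap
    replace hx : x ^ Q = x := by rw [hQdef, ← hσe e x]; exact hx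
    replace hy : y ^ Q = y := by rw [hQdef, ← hσe e y]; exact hy
    exact ⟨hx, hy⟩

/-! ## §2 A `p`-divisible `p`-primary subgroup with finite image lies in the kernel -/

/-- A `p`-primary, `p`-divisible subgroup `N` whose image under a homomorphism `f` is finite lies in `ker f`:
multiplication by `p` on the finite image is surjective, hence injective, so the image has no `p`-torsion, hence is `0`.
[cite: SilvermanAEC2009, V.§1 (proof of Thm. V.1.1)] -/
theorem le_ker_of_divisible_of_finite_map {A B : Type*} [AddCommGroup A] [AddCommGroup B] (f : A →+ B) (p : ℕ)
    (N : AddSubgroup A) (hprim : ∀ c ∈ N, ∃ k : ℕ, p ^ k • c = 0) (hdiv : ∀ c ∈ N, ∃ c' ∈ N, p • c' = c)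
    (hfin : ((N.map f : AddSubgroup B) : Set B).Finite) : N ≤ f.ker := by
  set Q : AddSubgroup B := N.map f with hQdef
  haveI : Finite Q := hfin.to_subtype
  let m : Q → Q := fun q ↦ ⟨p • (q : B), Q.nsmul_mem q.2 p⟩
  have hmsurj : Function.Surjective m := by
    rintro ⟨_, c, hc, rfl⟩
    obtain ⟨c', hc', hpc'⟩ := hdiv c hc
    exact ⟨⟨f c', ⟨c', hc', rfl⟩⟩, Subtype.ext (by change p • f c' = f c; rw [← map_nsmul, hpc'])⟩
  have hminj : Function.Injective m := Finite.injective_iff_surjective.mpr hmsurj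
  have hkill : ∀ q : Q, p • (q : B) = 0 → q = 0 := by
    intro q hq
    apply hminj
    apply Subtype.ext
    change p • (q : B) = p • ((0 : Q) : B)
    rw [hq, ZeroMemClass.coe_zero, smul_zero]
  have hkillpow : ∀ (k : ℕ) (q : Q), p ^ k • (q : B) = 0 → q = 0 := by
    intro k
    induction k with
    | zero => intro q hq; rw [pow_zero, one_smul] at hq; exact Subtype.ext hq
    | succ k ih =>
      intro q hq
      rw [pow_succ', mul_smul] at hq
      have h1 : (⟨p ^ k • (q : B), Q.nsmul_mem q.2 _⟩ : Q) = 0 :=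
        hkill ⟨p ^ k • (q : B), Q.nsmul_mem q.2 _⟩ hq
      exact ih q (congrArg Subtype.val h1)
  intro c hc
  rw [AddMonoidHom.mem_ker]
  obtain ⟨k, hk⟩ := hprim c hc
  have h := hkillpow k ⟨f c, ⟨c, hc, rfl⟩⟩ (by
    change p ^ k • f c = 0
    rw [← map_nsmul, hk, map_zero])
  exact congrArg Subtype.val h

/-! ## §3 The Weil pairing: an element fixing `μ_{p^∞}` and a point `P` of order `p^n` moves `E[p^n]` inside `ℤ·P` -/

/-- **Annihilators under the Weil pairing.**  Let `E/F` be an elliptic curve over a perfect field with `p ≠ char F`,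
`σ ∈ Γ_F` an element fixing every `p`-power root of unity of `F̄` and a point `P ∈ E(F̄)` of exact order `p^n`.  Then
`σ` moves every `R ∈ E[p^n]` inside `ℤ·P`: `σ R - R ∈ ℤ·P`.  Proof: `e_{p^n}(P, σR) = e_{p^n}(σP, σR) = σ e_{p^n}(P, R) =
e_{p^n}(P, R)`, so `σ R - R` lies in the annihilator of `P`, which is `ℤ·P` by counting (`#E[p^n] = p^{2n}`, and
`S ↦ e_{p^n}(P, S)` takes a value of exact order `p^n` by non-degeneracy at `p^{n-1} P ≠ 0`).
[cite: SilvermanAEC2009, Prop. III.8.1 and Cor. III.6.4] -/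
theorem smul_sub_mem_zmultiples_of_fixing_rootsOfUnity {F : Type u} [Field F] [PerfectField F]
    (E : WeierstrassCurve F) [E.IsElliptic] {p : ℕ} (hp : p.Prime) (hpF : (p : F) ≠ 0) {n : ℕ}
    {σ : absoluteGaloisGroup F} (hσμ : ∀ (k : ℕ) (ξ : AlgebraicClosure F), ξ ^ p ^ k = 1 → σ • ξ = ξ)
    {P : geomPoints E} (hPord : addOrderOf P = p ^ n) (hσP : σ • P = P)
    {R : geomPoints E} (hR : R ∈ geomTorsion E ((p ^ n : ℕ) : ℤ)) :
    σ • R - R ∈ AddSubgroup.zmultiples P := by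
  haveI := Fact.mk hp
  rcases n with _ | n
  · -- `E[1] = 0`
    have hR0 : R = 0 := by
      have h := (mem_geomTorsion_iff E _ R).mp hR
      rwa [pow_zero, Nat.cast_one, one_smul] at h
    rw [hR0, smul_zero, sub_zero]
    exact AddSubgroup.zero_mem _
  set m : ℕ := p ^ (n + 1) with hmdef
  have hm0 : m ≠ 0 := pow_ne_zero _ hp.ne_zero
  have hm2 : 2 ≤ m := le_trans hp.two_le (by rw [hmdef, pow_succ]; exact Nat.le_mul_of_pos_left p (pow_pos hp.pos n))
  have hmF : (m : F) ≠ 0 := by rw [hmdef, Nat.cast_pow]; exact pow_ne_zero _ hpF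
  obtain ⟨e, hpow, haddl, haddr, halt, hnd, hgal⟩ := E.exists_weilPairing_holds m hm2 hmF
  -- elementary consequences of bilinearity
  have hne : ∀ S U : geomTorsion E (m : ℤ), e S U ≠ 0 := fun S U h0 ↦ by
    have h1 := hpow S U
    rw [h0, zero_pow hm0] at h1
    exact zero_ne_one h1
  have he0r : ∀ S : geomTorsion E (m : ℤ), e S 0 = 1 := fun S ↦ by
    have h := haddr S 0 0
    rw [add_zero] at h
    exact (mul_eq_left₀ (hne S 0)).mp h.symm
  have he0l : ∀ U : geomTorsion E (m : ℤ), e 0 U = 1 := fun U ↦ by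
    have h := haddl 0 0 U
    rw [add_zero] at h
    exact (mul_eq_left₀ (hne 0 U)).mp h.symm
  have hskew : ∀ S U : geomTorsion E (m : ℤ), e S U * e U S = 1 := fun S U ↦ by
    have h := halt (S + U)
    rw [haddl, haddr, haddr, halt, halt, one_mul, mul_one] at h
    exact h
  have hnsmul_left : ∀ (j : ℕ) (S U : geomTorsion E (m : ℤ)), e (j • S) U = e S U ^ j := by
    intro j S U
    induction j with
    | zero => rw [zero_smul, pow_zero, he0l]
    | succ j ih => rw [succ_nsmul, haddl, ih, pow_succ]
  -- `P` as a point of `E[m]`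
  have hPm : P ∈ geomTorsion E (m : ℤ) := by
    rw [mem_geomTorsion_iff, natCast_zsmul, ← hPord]
    exact addOrderOf_nsmul_eq_zero P
  set Pt : geomTorsion E (m : ℤ) := ⟨P, hPm⟩ with hPtdef
  have hPtord : addOrderOf Pt = m := by
    have h := addOrderOf_injective (geomTorsion E (m : ℤ)).subtype Subtype.coe_injective Pt
    rw [← h]
    exact hPord
  -- the character `S ↦ e(P, S)` of `E[m]`
  let ψ : geomTorsion E (m : ℤ) →+ Additive ((AlgebraicClosure F)ˣ) :=
    { toFun := fun S ↦ Additive.ofMul (Units.mk0 (e Pt S) (hne Pt S))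
      map_zero' := by
        rw [ofMul_eq_zero]
        exact Units.ext (by rw [Units.val_mk0, he0r, Units.val_one])
      map_add' := fun S U ↦ by
        rw [← ofMul_mul]
        congr 1
        exact Units.ext (by rw [Units.val_mk0, Units.val_mul, Units.val_mk0, Units.val_mk0, haddr]) }
  have hψ : ∀ S : geomTorsion E (m : ℤ), ψ S = Additive.ofMul (Units.mk0 (e Pt S) (hne Pt S)) := fun S ↦ rfl
  have hker : ∀ S : geomTorsion E (m : ℤ), S ∈ ψ.ker ↔ e Pt S = 1 := fun S ↦ by
    rw [AddMonoidHom.mem_ker, hψ, ofMul_eq_zero, ← Units.val_eq_one, Units.val_mk0]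
  -- `ℤ·P ≤ ker ψ`
  have hle : AddSubgroup.zmultiples Pt ≤ ψ.ker :=
    AddSubgroup.zmultiples_le_of_mem ((hker Pt).mpr (halt Pt))
  -- `#E[m] = p^{2(n+1)}`, `E[m]` finite
  have hcardT : Nat.card (geomTorsion E (m : ℤ)) = p ^ (2 * (n + 1)) :=
    card_geomTorsion_pow_eq E p (card_torsionPoints_eq_sq_holds E (AlgebraicClosure F)) hpF (n + 1)
  haveI : Finite (geomTorsion E (m : ℤ)) :=
    Nat.finite_of_card_ne_zero (by rw [hcardT]; exact pow_ne_zero _ hp.ne_zero)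
  -- a value of `e(P, ·)` of exact order `m`
  have hPt' : p ^ n • Pt ≠ 0 := by
    intro h0
    have h1 : addOrderOf Pt ∣ p ^ n := addOrderOf_dvd_of_nsmul_eq_zero h0
    rw [hPtord, hmdef] at h1
    exact absurd (Nat.le_of_dvd (pow_pos hp.pos n) h1) (not_le.mpr (Nat.pow_lt_pow_right hp.one_lt (by omega)))
  obtain ⟨S₀, hS₀⟩ : ∃ S₀ : geomTorsion E (m : ℤ), e (p ^ n • Pt) S₀ ≠ 1 := by
    by_contra hall
    push Not at hall
    have h2 : ∀ S : geomTorsion E (m : ℤ), e S (p ^ n • Pt) = 1 := fun S ↦ by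
      have h := hskew S (p ^ n • Pt)
      rw [hall S, mul_one] at h
      exact h
    exact hPt' (hnd _ h2)
  have hord : orderOf (e Pt S₀) = p ^ (n + 1) := by
    refine orderOf_eq_prime_pow ?_ (hpow Pt S₀)
    rw [← hnsmul_left]; exact hS₀
  -- counting: `#ker ψ ≤ p^{n+1}`
  have hdvd : p ^ (n + 1) ∣ Nat.card ψ.range := by
    have h0 : addOrderOf (ψ S₀) = p ^ (n + 1) := by
      rw [hψ, addOrderOf_ofMul_eq_orderOf, ← orderOf_units, Units.val_mk0, hord]
    have h1 : addOrderOf (⟨ψ S₀, ⟨S₀, rfl⟩⟩ : ψ.range) = p ^ (n + 1) := by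
      rw [← h0]
      exact (addOrderOf_injective ψ.range.subtype Subtype.coe_injective _).symm
    rw [← h1]
    exact addOrderOf_dvd_natCard _
  have hcard_ker : Nat.card ψ.ker ≤ p ^ (n + 1) := by
    have h1 : Nat.card ψ.ker * Nat.card ψ.range = p ^ (2 * (n + 1)) := by
      rw [← AddSubgroup.index_ker, AddSubgroup.card_mul_index, hcardT]
    obtain ⟨t, ht⟩ := hdvd
    have ht0 : t ≠ 0 := by
      rintro rfl
      rw [mul_zero] at ht
      rw [ht, mul_zero] at h1
      exact absurd h1.symm (pow_ne_zero _ hp.ne_zero)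
    have h2 : Nat.card ψ.ker * t = p ^ (n + 1) := by
      have h3 : p ^ (n + 1) * (Nat.card ψ.ker * t) = p ^ (n + 1) * p ^ (n + 1) := by
        rw [← pow_add, show n + 1 + (n + 1) = 2 * (n + 1) by ring, ← h1, ht]; ring
      exact Nat.eq_of_mul_eq_mul_left (pow_pos hp.pos _) h3
    calc Nat.card ψ.ker ≤ Nat.card ψ.ker * t := Nat.le_mul_of_pos_right _ (Nat.pos_of_ne_zero ht0)
      _ = p ^ (n + 1) := h2
  have hcard_zmul : Nat.card (AddSubgroup.zmultiples Pt) = p ^ (n + 1) := by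
    rw [Nat.card_zmultiples, hPtord]
  have hkerEq : AddSubgroup.zmultiples Pt = ψ.ker :=
    AddSubgroup.eq_of_le_of_card_ge hle (by rw [hcard_zmul]; exact hcard_ker)
  -- `σ R - R` is annihilated by `P`
  set Rt : geomTorsion E (m : ℤ) := ⟨R, hR⟩ with hRtdef
  have hσPt : σ • Pt = Pt := Subtype.ext (by
    rw [Literature.NumberTheory.EllipticCurves.AddSubgroup.torsionBy.coe_smul]; exact hσP)
  have h1 : e Pt (σ • Rt) = e Pt Rt := by
    conv_lhs => rw [← hσPt]
    rw [← hgal, hσμ (n + 1) _ (hpow Pt Rt)]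
  have h2 : e Pt (σ • Rt - Rt) = 1 := by
    have h := haddr Pt (σ • Rt - Rt) Rt
    rw [sub_add_cancel, h1] at h
    exact ((mul_eq_right₀ (hne Pt Rt)).mp h.symm)
  have hmem : σ • Rt - Rt ∈ AddSubgroup.zmultiples Pt := by
    rw [hkerEq]; exact (hker _).mpr h2
  obtain ⟨j, hj⟩ := AddSubgroup.mem_zmultiples_iff.mp hmem
  refine AddSubgroup.mem_zmultiples_iff.mpr ⟨j, ?_⟩
  have h := congrArg (fun x : geomTorsion E (m : ℤ) ↦ (x : geomPoints E)) hj
  rw [AddSubgroupClass.coe_zsmul, AddSubgroupClass.coe_sub,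
    Literature.NumberTheory.EllipticCurves.AddSubgroup.torsionBy.coe_smul] at h
  exact h
end Literature.NumberTheory.EllipticCurves.IwasawaTowerTorsion.FiniteOrdinary

end Part1

/-!
## Part 2 — port of `Summits/BirchSwinnertonDyer/Rank1Residual/X11b/AnticyclotomicLocalTowerTorsion.lean` (2 declarations kept)

# Layer subgroups of a `ℤ_p`-extension: `g^{p^n} ∈ Γ_n`, and an element lying in every layer subgroup lies in `ker κ` (pro-`p` descent along the tower)

Declarations of this Part (verbatim port; each keeps its own docstring and citation): `mem_kerSubgroup_of_forall_mem_layerSubgroup`, `pow_prime_pow_mem_layerSubgroup`.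

Reference keys (see `references.bib` and the declarations' citations): [Washington1997].
-/

section Part2

open scoped _root_.Classical

open _root_.NumberField _root_.IsDedekindDomain _root_.Field
open Literature.NumberTheory.EllipticCurves Literature.NumberTheory.EllipticCurves.GreenbergSelmer
open Literature.NumberTheory.GaloisRepresentations

universe u

namespace Literature.NumberTheory.EllipticCurves.IwasawaTowerTorsion.LayerSubgroups

variable {K : Type u} [Field K] [NumberField K] {p : ℕ} [Fact p.Prime] (κ : ZpExtension K p)

omit [NumberField K] in
/-- **`⋂_n κ⁻¹(p^n ℤ_p) = ker κ`**: an element of every layer subgroup lies in `ker κ = Gal(K̄/K_∞)`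
(`K_∞ = ⋃ K_n`). [cite: Washington1997, §13.1] -/
theorem mem_kerSubgroup_of_forall_mem_layerSubgroup {σ : absoluteGaloisGroup K}
    (h : ∀ n : ℕ, σ ∈ κ.layerSubgroup n) : σ ∈ κ.kerSubgroup := by
  rw [ZpExtension.mem_kerSubgroup]
  have h0 : (κ σ).toAdd = 0 :=
    ZpExtension.PadicUnits.eq_zero_of_forall_pow_dvd fun n ↦ ZpExtension.mem_layerSubgroup.mp (h n)
  exact toAdd_eq_zero.mp h0

omit [NumberField K] in
/-- `σ^{p^n} ∈ κ⁻¹(p^n ℤ_p)` for every `σ ∈ Γ_K` (`κ(σ^{p^n}) = p^n κ(σ)`). [cite: Washington1997, §13.1] -/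
theorem pow_prime_pow_mem_layerSubgroup (σ : absoluteGaloisGroup K) (n : ℕ) :
    σ ^ p ^ n ∈ κ.layerSubgroup n := by
  rw [ZpExtension.mem_layerSubgroup, map_pow, toAdd_pow, nsmul_eq_mul, Nat.cast_pow]
  exact dvd_mul_right _ _

end Literature.NumberTheory.EllipticCurves.IwasawaTowerTorsion.LayerSubgroups

end Part2

/-!
## Part 3 — port of `Summits/BirchSwinnertonDyer/BirchSwinnertonDyer/Theorems/SchneiderFreeAdditiveX3LocalTowerTorsionLine.lean` (2 declarations kept)

# Local tower torsion finiteness reduced to the canonical line: the local tower torsion lies in any `D_𝔭`-stable subgroup modulo which some element of `D_𝔭` acts as `−1`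

Declarations of this Part (verbatim port; each keeps its own docstring and citation): `exists_layerSubgroup_inf_subset`, `exists_nsmul_order_layer`.

Reference keys (see `references.bib` and the declarations' citations): [Washington1997].
-/

section Part3

open scoped _root_.Classical

namespace Literature.NumberTheory.EllipticCurves.IwasawaTowerTorsion.LocalTowerTorsionLine

open _root_.NumberField _root_.IsDedekindDomain _root_.Field _root_.WeierstrassCurve
  Literature.NumberTheory.EllipticCurves Literature.NumberTheory.EllipticCurves.GreenbergSelmer
  Literature.NumberTheory.GaloisRepresentations
  Literature.NumberTheory.EllipticCurves.IwasawaTowerTorsion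

variable {K : Type} [Field K] [NumberField K] {p : ℕ} [hp : Fact p.Prime] (κ : ZpExtension K p)

section Generic

variable {M : Type} [AddCommGroup M] [DistribMulAction (absoluteGaloisGroup K) M]
  [TopologicalSpace M] [DiscreteTopology M]

/-- **Compactness along the layers.** For `D ≤ Γ_K` closed and an open set `V ⊆ Γ_K` containing
`N = D ⊓ ker κ`, some layer `D ⊓ κ⁻¹(pⁿ ℤ_p)` lies in `V`: the closed sets `(D ∩ κ⁻¹(pⁿℤ_p)) ∖ V`
decrease to `(D ∩ ker κ) ∖ V = ∅` in the compact group `Γ_K` (`⋂ₙ κ⁻¹(pⁿ ℤ_p) = ker κ`).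
[cite: Washington1997, §13.1] -/
theorem exists_layerSubgroup_inf_subset (D : Subgroup (absoluteGaloisGroup K))
    (hD : IsClosed (D : Set (absoluteGaloisGroup K))) {V : Set (absoluteGaloisGroup K)}
    (hV : IsOpen V) (hN : ∀ g ∈ D ⊓ κ.kerSubgroup, g ∈ V) :
    ∃ n : ℕ, ∀ g ∈ D ⊓ κ.layerSubgroup n, g ∈ V := by
  set F : ℕ → Set (absoluteGaloisGroup K) := fun n ↦ (κ.layerSubgroup n : Set _) ∩ Vᶜ with hF
  have hFclosed : ∀ n, IsClosed (F n) := fun n ↦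
    ((κ.layerSubgroup n).isClosed_of_isOpen (κ.isOpen_layerSubgroup n)).inter hV.isClosed_compl
  have hFdir : Directed (· ⊇ ·) F := fun i j ↦ ⟨max i j,
    Set.inter_subset_inter_left _ (κ.layerSubgroup_antitone (le_max_left i j)),
    Set.inter_subset_inter_left _ (κ.layerSubgroup_antitone (le_max_right i j))⟩
  have hempty : (D : Set (absoluteGaloisGroup K)) ∩ ⋂ n, F n = ∅ := by
    rw [Set.eq_empty_iff_forall_notMem]
    rintro g ⟨hgD, hgF⟩
    rw [Set.mem_iInter] at hgF
    have hgker : g ∈ κ.kerSubgroup :=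
      LayerSubgroups.mem_kerSubgroup_of_forall_mem_layerSubgroup κ fun n ↦ (hgF n).1
    exact (hgF 0).2 (hN g (Subgroup.mem_inf.mpr ⟨hgD, hgker⟩))
  obtain ⟨n, hn⟩ := hD.isCompact.elim_directed_family_closed F hFclosed hempty hFdir
  refine ⟨n, fun g hg ↦ ?_⟩
  obtain ⟨hgD, hgL⟩ := Subgroup.mem_inf.mp hg
  by_contra hgV
  have : g ∈ (D : Set (absoluteGaloisGroup K)) ∩ F n := ⟨hgD, hgL, hgV⟩
  rw [hn] at this
  exact this

omit [NumberField K] hp [DistribMulAction (absoluteGaloisGroup K) M] [TopologicalSpace M]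
  [DiscreteTopology M] in
omit [NumberField K] hp [DistribMulAction (absoluteGaloisGroup K) M] [TopologicalSpace M]
  [DiscreteTopology M] in
/-- In a `p`-primary group, an element not killed by `p^j` has a multiple of order exactly
`p^(j+1)`… precisely: if `p^k x = 0` and `p^j x ≠ 0` then some multiple `y = p^i x` has
`p^(j+1) y = 0` and `p^j y ≠ 0`. [cite: Washington1997, §13.1] -/
theorem exists_nsmul_order_layer {x : M} {k j : ℕ} (hk : p ^ k • x = 0) (hj : p ^ j • x ≠ 0) :
    ∃ i : ℕ, p ^ (j + 1) • (p ^ i • x) = 0 ∧ p ^ j • (p ^ i • x) ≠ 0 := by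
  classical
  -- the least `k₀` with `p^{k₀} x = 0`; then `j < k₀`, take `i = k₀ - (j+1)`
  have hex : ∃ k₀, p ^ k₀ • x = 0 := ⟨k, hk⟩
  set k₀ := Nat.find hex with hk₀def
  have hk₀ : p ^ k₀ • x = 0 := Nat.find_spec hex
  have hjk : j < k₀ := by
    by_contra h
    push Not at h
    apply hj
    obtain ⟨d, hd⟩ := Nat.exists_eq_add_of_le h
    rw [hd, pow_add, mul_comm, mul_smul, hk₀, smul_zero]
  refine ⟨k₀ - (j + 1), ?_, ?_⟩
  · rw [smul_smul, ← pow_add, show j + 1 + (k₀ - (j + 1)) = k₀ by omega, hk₀]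
  · intro h
    rw [smul_smul, ← pow_add] at h
    have hlt : j + (k₀ - (j + 1)) < k₀ := by omega
    exact Nat.find_min hex hlt h

end Generic

end Literature.NumberTheory.EllipticCurves.IwasawaTowerTorsion.LocalTowerTorsionLine

end Part3

/-!
## Part 4 — port of `Summits/BirchSwinnertonDyer/BirchSwinnertonDyer/Theorems/SchneiderFreeAdditiveX3LocalTowerTorsionLineClauses.lean` (4 declarations kept)

# The numeric clauses of the canonical line from its divisibility

Declarations of this Part (verbatim port; each keeps its own docstring and citation): `top_le_of_pTorsion_le_of_divisible`, `ncard_pTorsion_le_of_divisible_of_ne_top`, `exists_addOrderOf_eq_pow_of_divisible_of_ne_bot`, `ncard_geomPrimaryTorsion_pTorsion_eq_sq`.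

Reference keys (see `references.bib` and the declarations' citations): [SilvermanAEC2009].
-/

section Part4

open scoped _root_.Classical

namespace Literature.NumberTheory.EllipticCurves.IwasawaTowerTorsion.LocalTowerTorsionLine

open _root_.WeierstrassCurve Literature.NumberTheory.EllipticCurves

section Generic

variable {M : Type} [AddCommGroup M] {p : ℕ} [hp : Fact p.Prime]

omit hp in
/-- **`M[p] ⊆ C` and `C` divisible ⇒ `C = M`** for a `p`-primary `M`: by induction on the exponent,
`p^{n+1} m = 0 ⇒ p m ∈ C ⇒ p m = p c'` (`c' ∈ C`) `⇒ m − c' ∈ M[p] ⊆ C`. [cite: SilvermanAEC2009, Cor. III.6.4] -/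
theorem top_le_of_pTorsion_le_of_divisible (C : AddSubgroup M)
    (htor : ∀ m : M, ∃ k : ℕ, p ^ k • m = 0)
    (hdiv : ∀ c ∈ C, ∃ c' ∈ C, p • c' = c) (h1 : ∀ m : M, p • m = 0 → m ∈ C) : C = ⊤ := by
  have key : ∀ n : ℕ, ∀ m : M, p ^ n • m = 0 → m ∈ C := by
    intro n
    induction n with
    | zero => intro m hm; rw [pow_zero, one_smul] at hm; rw [hm]; exact C.zero_mem
    | succ n ih =>
      intro m hm
      have hpm : p • m ∈ C := ih _ (by rw [smul_smul, ← pow_succ, hm])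
      obtain ⟨c', hc', hpc'⟩ := hdiv _ hpm
      have hmc : m - c' ∈ C := h1 _ (by rw [smul_sub, hpc', sub_self])
      have : m = (m - c') + c' := (sub_add_cancel m c').symm
      rw [this]
      exact C.add_mem hmc hc'
  rw [eq_top_iff]
  intro m _
  obtain ⟨k, hk⟩ := htor m
  exact key k m hk

/-- **A proper divisible subgroup has at most `p` points killed by `p`** when `#M[p] = p²`
(`M` `p`-primary): `C[p] ≤ M[p]` has order `1`, `p` or `p²` (Lagrange), and `p²` would give `M[p] ⊆ C`,
hence `C = M`. [cite: SilvermanAEC2009, Cor. III.6.4] -/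
theorem ncard_pTorsion_le_of_divisible_of_ne_top (C : AddSubgroup M)
    (htor : ∀ m : M, ∃ k : ℕ, p ^ k • m = 0)
    (hM1 : Set.ncard {m : M | p • m = 0} = p ^ 2)
    (hdiv : ∀ c ∈ C, ∃ c' ∈ C, p • c' = c) (htop : C ≠ ⊤) :
    Set.ncard {c : M | c ∈ C ∧ p • c = 0} ≤ p := by
  -- the subgroups `V = M[p]` and `C₁ = C ∩ M[p]`
  let V : AddSubgroup M :=
    { carrier := {m | p • m = 0}
      add_mem' := fun {a b} ha hb ↦ by
        simp only [Set.mem_setOf_eq] at ha hb ⊢; rw [smul_add, ha, hb, add_zero]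
      zero_mem' := smul_zero _
      neg_mem' := fun {a} ha ↦ by simp only [Set.mem_setOf_eq] at ha ⊢; rw [smul_neg, ha, neg_zero] }
  have hVmem : ∀ m : M, m ∈ V ↔ p • m = 0 := fun m ↦ Iff.rfl
  have hVset : (V : Set M) = {m : M | p • m = 0} := rfl
  have hVfin : (V : Set M).Finite := by
    rw [hVset]; apply Set.finite_of_ncard_pos; rw [hM1]; exact pow_pos hp.out.pos 2
  haveI : Finite V := hVfin.to_subtype
  have hVcard : Nat.card V = p ^ 2 := by
    rw [← hVset, ← Nat.card_coe_set_eq] at hM1; exact hM1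
  let C₁ : AddSubgroup M := C ⊓ V
  have hC₁set : (C₁ : Set M) = {c : M | c ∈ C ∧ p • c = 0} := by
    ext m
    rw [SetLike.mem_coe, AddSubgroup.mem_inf, hVmem]
    rfl
  have hle : C₁ ≤ V := inf_le_right
  haveI : Finite C₁ := Finite.of_injective _ (AddSubgroup.inclusion_injective hle)
  have hdvd : Nat.card C₁ ∣ p ^ 2 := hVcard ▸ AddSubgroup.card_dvd_of_le hle
  obtain ⟨i, hi2, hi⟩ := (Nat.dvd_prime_pow hp.out).mp hdvd
  rw [← hC₁set, ← Nat.card_coe_set_eq, SetLike.coe_sort_coe, hi]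
  -- `i ≤ 1`: `i = 2` would force `C₁ = V`, `M[p] ⊆ C`, `C = ⊤`
  have hi1 : i ≤ 1 := by
    by_contra hgt
    have hi2' : i = 2 := by omega
    have heq : C₁ = V := AddSubgroup.eq_of_le_of_card_ge hle (by rw [hi, hi2', hVcard])
    refine htop (top_le_of_pTorsion_le_of_divisible C htor hdiv fun m hm ↦ ?_)
    have : m ∈ C₁ := by rw [heq]; exact (hVmem m).mpr hm
    exact (AddSubgroup.mem_inf.mp this).1
  calc p ^ i ≤ p ^ 1 := Nat.pow_le_pow_right hp.out.pos hi1
    _ = p := pow_one p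

/-- **A non-zero divisible subgroup of a `p`-primary group has points of every order `p^k`**:
a non-zero `c ∈ C` is `p^{k}`-divisible inside `C`, `c = p^k c_k`, and a suitable multiple of `c_k`
has order exactly `p^k`. [cite: SilvermanAEC2009, Cor. III.6.4] -/
theorem exists_addOrderOf_eq_pow_of_divisible_of_ne_bot (C : AddSubgroup M)
    (htor : ∀ m : M, ∃ k : ℕ, p ^ k • m = 0)
    (hdiv : ∀ c ∈ C, ∃ c' ∈ C, p • c' = c) (hbot : C ≠ ⊥) (k : ℕ) :
    ∃ c ∈ C, addOrderOf c = p ^ k := by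
  rcases k with _ | k
  · exact ⟨0, C.zero_mem, by rw [pow_zero, addOrderOf_zero]⟩
  obtain ⟨c, hcC, hc0⟩ : ∃ c ∈ C, c ≠ 0 := by
    by_contra h
    push Not at h
    exact hbot ((AddSubgroup.eq_bot_iff_forall _).mpr h)
  -- `c = p^k • x` with `x ∈ C`
  have hdivk : ∀ n : ℕ, ∃ x ∈ C, p ^ n • x = c := by
    intro n
    induction n with
    | zero => exact ⟨c, hcC, by rw [pow_zero, one_smul]⟩
    | succ n ih =>
      obtain ⟨x, hxC, hx⟩ := ih
      obtain ⟨x', hx'C, hx'⟩ := hdiv x hxC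
      exact ⟨x', hx'C, by rw [pow_succ, mul_smul, hx', hx]⟩
  obtain ⟨x, hxC, hx⟩ := hdivk k
  obtain ⟨K₀, hK₀⟩ := htor x
  have hxk : p ^ k • x ≠ 0 := by rw [hx]; exact hc0
  obtain ⟨i, hi1, hi0⟩ := exists_nsmul_order_layer (p := p) hK₀ hxk
  exact ⟨p ^ i • x, C.nsmul_mem hxC _, addOrderOf_eq_prime_pow hi0 hi1⟩

end Generic

section Curve

variable {K : Type} [Field K] [NumberField K] (E : WeierstrassCurve K) [E.IsElliptic] {p : ℕ}
  [hp : Fact p.Prime]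

/-- `#E[p^∞][p] = p²`: the points of `E(K̄)[p^∞]` killed by `p` are `E[p]`, of order `p²`
(Silverman III.6.4 in the tree: `card_torsionPoints_eq_sq_holds`). [cite: SilvermanAEC2009, Cor. III.6.4] -/
theorem ncard_geomPrimaryTorsion_pTorsion_eq_sq :
    Set.ncard {m : E.geomPrimaryTorsion p | p • m = 0} = p ^ 2 := by
  have hp0 : (p : K) ≠ 0 := Nat.cast_ne_zero.mpr hp.out.ne_zero
  have hcard : Nat.card (E.geomTorsion (p ^ 1 : ℕ)) = p ^ (2 * 1) :=
    card_geomTorsion_pow_eq E p (card_torsionPoints_eq_sq_holds E (AlgebraicClosure K)) hp0 1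
  rw [pow_one, mul_one] at hcard
  rw [← hcard, ← Nat.card_coe_set_eq]
  -- bijection `{m ∈ E[p^∞] | p m = 0} ≃ E[p]`
  refine Nat.card_congr
    { toFun := fun m ↦ ⟨(m.1 : E.geomPoints), AddSubgroup.torsionBy.nsmul_iff.mpr (by
        rw [← AddSubgroupClass.coe_nsmul, m.2, ZeroMemClass.coe_zero])⟩
      invFun := fun P ↦ ⟨⟨(P : E.geomPoints), ⟨1, by
        rw [pow_one]; exact AddSubgroup.torsionBy.nsmul_iff.mp P.2⟩⟩, Subtype.ext (by
        rw [AddSubgroupClass.coe_nsmul, ZeroMemClass.coe_zero]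
        exact AddSubgroup.torsionBy.nsmul_iff.mp P.2)⟩
      left_inv := fun m ↦ by ext; rfl
      right_inv := fun P ↦ by ext; rfl }

end Curve

end Literature.NumberTheory.EllipticCurves.IwasawaTowerTorsion.LocalTowerTorsionLine

end Part4

/-!
## Part 5 — port of `Summits/BirchSwinnertonDyer/BirchSwinnertonDyer/Theorems/LocalTowerTorsionFiniteOfNoStableDivisibleLine.lean` (1 declarations kept)

# Local tower torsion finiteness without a line: the local tower torsion is finite as soon as `E[p^∞]` carries no `D_𝔭`-stable divisible line and the local tower group moves some `p`-torsion point

Declarations of this Part (verbatim port; each keeps its own docstring and citation): `localTowerTorsionFiniteAt_of_noStableDivisibleLine`.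

Reference keys (see `references.bib` and the declarations' citations): [GreenbergLNM1716], [JetchevSkinnerWan2017].
-/

section Part5

open scoped _root_.Classical AddSubgroup

namespace Literature.NumberTheory.EllipticCurves.IwasawaTowerTorsion.WeierstrassCurve

open _root_.WeierstrassCurve

open _root_.NumberField _root_.IsDedekindDomain _root_.Field Literature.NumberTheory.EllipticCurves
  Literature.NumberTheory.EllipticCurves.GreenbergSelmer
  Literature.NumberTheory.EllipticCurves.IwasawaTowerTorsion.LocalTowerTorsionLine
  Literature.NumberTheory.EllipticCurves.IwasawaTowerTorsion

variable {K : Type} [Field K] [NumberField K] (E : WeierstrassCurve K) [E.IsElliptic] (p : ℕ)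
  [hp : Fact p.Prime] (κ : ZpExtension K p) (𝔭 : HeightOneSpectrum (𝓞 K))

/-- **Fin_v without a line.** For an elliptic curve `E` over a number field `K`, a prime `p`, a
`ℤ_p`-extension `κ` of `K` and a finite place `𝔭`: if (i) every `D_𝔭`-stable `p`-divisible subgroup
`N ≤ E(K̄)[p^∞]` with at most `p` points killed by `p` is zero (no `D_𝔭`-stable divisible LINE — the
torsion form of the irreducibility of `V_pE|_{G_{K_𝔭}}`, which holds at a prime of potentially
supersingular reduction), and (ii) the local tower group `D_𝔭 ⊓ ker κ` moves some `p`-torsion point of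
`E(K̄)`, then the `p`-primary torsion of `E` fixed by `D_𝔭 ⊓ ker κ` — `E(K_{∞,w})[p^∞]` at the place
`w ∣ 𝔭` of the chosen embedding — is finite (`SchneiderFreeControlAtoms.LocalTowerTorsionFiniteAt`).
The fixed module is `D_𝔭`-stable; were it infinite, its stable image `p^{j₀}·(fixed module)` would be
a non-zero `D_𝔭`-stable divisible subgroup, proper by (ii), hence with `≤ p` points of order `p`
(`#E[p] = p²`), against (i). [cite: GreenbergLNM1716, §3 Lemma 3.3 (p. 87)]
[cite: JetchevSkinnerWan2017, Prop. 3.3.4 Case 3(b) (arXiv:1512.06894 p. 13)] -/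
theorem localTowerTorsionFiniteAt_of_noStableDivisibleLine
    (hline : ∀ N : AddSubgroup (E.geomPrimaryTorsion p),
      (∀ d ∈ decomp 𝔭, ∀ c ∈ N, d • c ∈ N) → (∀ c ∈ N, ∃ c' ∈ N, p • c' = c) →
      Set.ncard {c : E.geomPrimaryTorsion p | c ∈ N ∧ p • c = 0} ≤ p → N = ⊥)
    (hmove : ∃ m : E.geomPrimaryTorsion p, p • m = 0 ∧
      ∃ g ∈ decomp 𝔭 ⊓ κ.kerSubgroup, g • m ≠ m) :
    (FixedPoints.addSubgroup ↥(decomp 𝔭 ⊓ κ.kerSubgroup) (E.geomPrimaryTorsion p) :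
      Set (E.geomPrimaryTorsion p)).Finite := by
  have hpr : p.Prime := hp.out
  set M : AddSubgroup E.geomPoints := E.geomPrimaryTorsion p with hM
  set H : Subgroup (absoluteGaloisGroup K) := decomp 𝔭 ⊓ κ.kerSubgroup with hH
  set B : AddSubgroup M := FixedPoints.addSubgroup H M with hB
  by_contra hinf
  have hinfB : ¬ Finite B := fun h ↦ by
    haveI := h
    exact hinf (Set.toFinite _)
  -- `H` is normalised by `D_𝔭`: `d⁻¹ τ d ∈ H` for `d ∈ D_𝔭`, `τ ∈ H`
  have hconj : ∀ d ∈ decomp 𝔭, ∀ τ ∈ H, d⁻¹ * τ * d ∈ H := by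
    intro d hd τ hτ
    obtain ⟨hτD, hτk⟩ := Subgroup.mem_inf.mp hτ
    refine Subgroup.mem_inf.mpr ⟨(decomp 𝔭).mul_mem ((decomp 𝔭).mul_mem ((decomp 𝔭).inv_mem hd) hτD) hd, ?_⟩
    rw [ZpExtension.mem_kerSubgroup] at hτk ⊢
    rw [map_mul, map_mul, map_inv, hτk, mul_one, inv_mul_cancel]
  -- hence the fixed module `B` is `D_𝔭`-stable
  have hBstab : ∀ d ∈ decomp 𝔭, ∀ {m : M}, m ∈ B → d • m ∈ B := by
    intro d hd m hm
    rw [hB, FixedPoints.mem_addSubgroup] at hm ⊢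
    rintro ⟨τ, hτ⟩
    have h := hm ⟨d⁻¹ * τ * d, hconj d hd τ hτ⟩
    rw [Subgroup.mk_smul] at h ⊢
    calc τ • d • m = d • ((d⁻¹ * τ * d) • m) := by rw [mul_smul, mul_smul, smul_inv_smul]
      _ = d • m := by rw [h]
  -- `M` and `B` are `p`-primary, `B[p]` is finite
  have htorM : ∀ x : M, ∃ k : ℕ, p ^ k • x = 0 := fun x ↦ by
    obtain ⟨k, hk⟩ := x.2
    exact ⟨k, Subtype.ext (by rw [AddSubgroupClass.coe_nsmul, hk]; rfl)⟩
  have hprimB : ∀ b : B, ∃ k : ℕ, p ^ k • b = 0 := fun b ↦ by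
    obtain ⟨k, hk⟩ := htorM (b : M)
    exact ⟨k, Subtype.ext (by rw [AddSubgroupClass.coe_nsmul, hk]; rfl)⟩
  haveI : Finite (E.geomTorsion ((p : ℕ) : ℤ)) :=
    E.finite_torsionPoints_holds (AlgebraicClosure K) (by exact_mod_cast hpr.ne_zero)
  haveI : Finite ((B)[(p : ℕ)]) := by
    refine Finite.of_injective (fun x : (B)[(p : ℕ)] ↦
      (⟨(((x : B) : M) : E.geomPoints), ?_⟩ : E.geomTorsion ((p : ℕ) : ℤ))) ?_
    · refine AddSubgroup.torsionBy.nsmul_iff.mpr ?_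
      have h := congrArg (fun b : B ↦ ((b : M) : E.geomPoints))
        (AddSubgroup.torsionBy.nsmul_iff.mp x.2)
      simpa only [AddSubmonoidClass.coe_nsmul, ZeroMemClass.coe_zero] using h
    · intro x y hxy
      have h := congrArg Subtype.val hxy
      dsimp only at h
      exact Subtype.ext (Subtype.ext (Subtype.ext h))
  -- the stable image `D₀ = p^{j₀} B`: infinite and `p`-divisible
  obtain ⟨j₀, hj₀⟩ := PrimaryGroup.exists_powRange_succ_eq p hprimB
  obtain ⟨t, ht⟩ := PrimaryGroup.exists_card_quotient_powRange_le p hprimB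
  set D₀ : AddSubgroup B := (nsmulAddMonoidHom (p ^ j₀) : B →+ B).range with hD₀
  have hD₀inf : ¬ Finite D₀ := by
    intro hfin
    apply hinfB
    haveI := (ht j₀).1
    refine Nat.finite_of_card_ne_zero ?_
    rw [← AddSubgroup.card_mul_index D₀, AddSubgroup.index_eq_card]
    exact mul_ne_zero Nat.card_pos.ne' Nat.card_pos.ne'
  have hdiv₀ : ∀ x ∈ D₀, ∃ y ∈ D₀, p • y = x := by
    rintro x hx
    have hx' : x ∈ (nsmulAddMonoidHom (p ^ (j₀ + 1)) : B →+ B).range := by rw [hj₀]; exact hx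
    obtain ⟨c, rfl⟩ := hx'
    refine ⟨p ^ j₀ • c, ⟨c, rfl⟩, ?_⟩
    change p • p ^ j₀ • c = p ^ (j₀ + 1) • c
    rw [pow_succ', mul_smul]
  -- push the stable image down to `M = E[p^∞]`
  set N : AddSubgroup M := D₀.map B.subtype with hN
  have hNdiv : ∀ c ∈ N, ∃ c' ∈ N, p • c' = c := by
    rintro _ ⟨b, hb, rfl⟩
    obtain ⟨c, hc, hcb⟩ := hdiv₀ b hb
    exact ⟨B.subtype c, ⟨c, hc, rfl⟩, by rw [← map_nsmul, hcb]⟩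
  have hNstab : ∀ d ∈ decomp 𝔭, ∀ c ∈ N, d • c ∈ N := by
    rintro d hd _ ⟨b, ⟨c, rfl⟩, rfl⟩
    set c' : B := ⟨d • (c : M), hBstab d hd c.2⟩ with hc'
    refine ⟨p ^ j₀ • c', ⟨c', rfl⟩, ?_⟩
    rw [map_nsmul, nsmulAddMonoidHom_apply, map_nsmul, smul_comm d (p ^ j₀) (B.subtype c)]
    rfl
  have hNfix : ∀ c ∈ N, ∀ g ∈ H, g • c = c := by
    rintro _ ⟨b, -, rfl⟩ g hg
    have hb : (b : M) ∈ FixedPoints.addSubgroup H M := b.2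
    rw [FixedPoints.mem_addSubgroup] at hb
    have h := hb ⟨g, hg⟩
    rw [Subgroup.mk_smul] at h
    exact h
  -- `N ≠ ⊤` by (ii)
  have hNtop : N ≠ ⊤ := by
    intro htop
    obtain ⟨m, -, g, hg, hne⟩ := hmove
    exact hne (hNfix m (by rw [htop]; exact AddSubgroup.mem_top m) g hg)
  -- so `#N[p] ≤ p`, and (i) kills `N`
  have hN1 : Set.ncard {c : E.geomPrimaryTorsion p | c ∈ N ∧ p • c = 0} ≤ p :=
    ncard_pTorsion_le_of_divisible_of_ne_top N htorM (ncard_geomPrimaryTorsion_pTorsion_eq_sq E)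
      hNdiv hNtop
  have hNbot : N = ⊥ := hline N hNstab hNdiv hN1
  apply hD₀inf
  haveI : Subsingleton D₀ := by
    refine ⟨fun x y ↦ Subtype.ext (B.subtype_injective ?_)⟩
    have hx : B.subtype (x : B) ∈ N := ⟨x, x.2, rfl⟩
    have hy : B.subtype (y : B) ∈ N := ⟨y, y.2, rfl⟩
    rw [hNbot, AddSubgroup.mem_bot] at hx hy
    rw [hx, hy]
  infer_instance

end Literature.NumberTheory.EllipticCurves.IwasawaTowerTorsion.WeierstrassCurve

end Part5

/-!
## Part 6 — port of `Summits/BirchSwinnertonDyer/BirchSwinnertonDyer/Theorems/LocalTowerMovesPTorsionOfNoRootsOfUnity.lean` (1 declarations kept)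

# The local tower group moves a `p`-torsion point: input (ii) of the line-free local tower torsion finiteness reduction, from the Weil pairing and `μ_p ⊄ K_𝔭`

Declarations of this Part (verbatim port; each keeps its own docstring and citation): `exists_pTorsion_not_fixed_of_no_primitiveRoot`.

Reference keys (see `references.bib` and the declarations' citations): [SilvermanAEC2009], [Washington1997].
-/

section Part6

open scoped _root_.Classical

namespace Literature.NumberTheory.EllipticCurves.IwasawaTowerTorsion.WeierstrassCurve

open _root_.WeierstrassCurve

open _root_.NumberField _root_.IsDedekindDomain _root_.Field Literature.NumberTheory.EllipticCurves
  Literature.NumberTheory.EllipticCurves.GreenbergSelmer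
  Literature.NumberTheory.GaloisRepresentations
  Literature.NumberTheory.EllipticCurves.IwasawaTowerTorsion
  Literature.NumberTheory.EllipticCurves.IwasawaTowerTorsion.LayerSubgroups
  Literature.NumberTheory.EllipticCurves.IwasawaTowerTorsion.LocalTowerTorsionLine

variable {K : Type} [Field K] [NumberField K] (E : WeierstrassCurve K) (p : ℕ)
  [hp : Fact p.Prime] (κ : ZpExtension K p) (𝔭 : HeightOneSpectrum (𝓞 K))

/-- **The local tower group moves a `p`-torsion point when `μ_p ⊄ K_𝔭`.** For an elliptic curve `E`
over a number field `K`, a prime `p`, a `ℤ_p`-extension `κ` of `K` and a finite place `𝔭` such that the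
completion `K_𝔭` contains no primitive `p`-th root of unity, there is a `p`-torsion point of `E(K̄)`
NOT fixed by `D_𝔭 ⊓ ker κ` (the decomposition group, in `Gal(K̄/K_∞)`, of the chosen prime above `𝔭`).
Otherwise the Weil pairing gives a primitive `p`-th root of unity `ζ` fixed by `D_𝔭 ⊓ ker κ`, the
pro-`p` quotient `D_𝔭/(D_𝔭 ⊓ ker κ)` acts on `μ_p` trivially (`a^{pⁿ} ≡ a (mod p)`), so `D_𝔭` fixes
`ζ` and `ζ ∈ K_𝔭`. [cite: SilvermanAEC2009, Prop. III.8.1 and Cor. III.8.1.1]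
[cite: Washington1997, §13.1] -/
theorem exists_pTorsion_not_fixed_of_no_primitiveRoot [E.IsElliptic]
    (hμ : ∀ z : 𝔭.adicCompletion K, ¬ IsPrimitiveRoot z p) :
    ∃ m : E.geomPrimaryTorsion p, p • m = 0 ∧ ∃ g ∈ decomp 𝔭 ⊓ κ.kerSubgroup, g • m ≠ m := by
  have hpr : p.Prime := hp.out
  by_contra hcon
  push Not at hcon
  -- every geometric `p`-torsion point is fixed by `H = D_𝔭 ⊓ ker κ`
  set H : Subgroup (absoluteGaloisGroup K) := decomp 𝔭 ⊓ κ.kerSubgroup with hH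
  have hfixT : ∀ (S : E.geomTorsion (p : ℤ)) (g : absoluteGaloisGroup K), g ∈ H → g • S = S := by
    intro S g hg
    have hS : (p : ℕ) • (S : E.geomPoints) = 0 := AddSubgroup.torsionBy.nsmul_iff.mp S.2
    set m : E.geomPrimaryTorsion p := ⟨(S : E.geomPoints), ⟨1, by rw [pow_one]; exact hS⟩⟩ with hm
    have hpm : p • m = 0 := Subtype.ext (by
      rw [AddSubgroupClass.coe_nsmul, ZeroMemClass.coe_zero]; exact hS)
    have h := congrArg (fun x : E.geomPrimaryTorsion p ↦ (x : E.geomPoints)) (hcon m hpm g hg)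
    simp only [primaryComponent.coe_smul] at h
    exact Subtype.ext (by rw [AddSubgroup.torsionBy.coe_smul]; exact h)
  -- the Weil pairing and a primitive `p`-th root of unity `ζ = e(S₀, T₀)`
  have hpK : ((p : ℕ) : K) ≠ 0 := Nat.cast_ne_zero.mpr hpr.ne_zero
  obtain ⟨w, hpow, haddl, -, -, hnd, hgal⟩ := E.exists_weilPairing_holds p hpr.two_le hpK
  have hpKbar : ((p : ℕ) : AlgebraicClosure K) ≠ 0 := Nat.cast_ne_zero.mpr hpr.ne_zero
  have hgeom : Nat.card (E.geomTorsion p) = p ^ 2 :=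
    card_torsionBy_eq_sq (E := E.baseChange (AlgebraicClosure K)) hpKbar
  haveI : Finite (E.geomTorsion p) :=
    Nat.finite_of_card_ne_zero (by rw [hgeom]; exact pow_ne_zero 2 hpr.ne_zero)
  have hnt : Nontrivial (E.geomTorsion p) := by
    rw [← Finite.one_lt_card_iff_nontrivial, hgeom]
    exact Nat.one_lt_pow two_ne_zero hpr.one_lt
  obtain ⟨T₀, hT₀⟩ := exists_ne (0 : E.geomTorsion p)
  obtain ⟨S₀, hS₀⟩ : ∃ S₀, w S₀ T₀ ≠ 1 := by
    by_contra h
    exact hT₀ (hnd T₀ fun S => by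
      by_contra h'
      exact h ⟨S, h'⟩)
  set ζ : AlgebraicClosure K := w S₀ T₀ with hζdef
  have hζp : ζ ^ p = 1 := hpow S₀ T₀
  have hζprim : IsPrimitiveRoot ζ p := by
    have h := IsPrimitiveRoot.orderOf ζ
    rwa [orderOf_eq_prime hζp hS₀] at h
  -- `H` fixes `ζ`
  have hHζ : ∀ g ∈ H, g • ζ = ζ := fun g hg ↦ by
    rw [hζdef, hgal g S₀ T₀, hfixT S₀ g hg, hfixT T₀ g hg]
  -- the stabiliser of `ζ` is open: it contains `Gal(K̄/K(ζ))`
  set V : Subgroup (absoluteGaloisGroup K) := MulAction.stabilizer (absoluteGaloisGroup K) ζ with hV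
  have hVopen : IsOpen (V : Set (absoluteGaloisGroup K)) := by
    haveI : FiniteDimensional K (IntermediateField.adjoin K {ζ}) :=
      IntermediateField.adjoin.finiteDimensional (Algebra.IsIntegral.isIntegral ζ)
    refine Subgroup.isOpen_mono ?_ (IntermediateField.fixingSubgroup_isOpen (IntermediateField.adjoin K {ζ}))
    intro g hg
    rw [MulAction.mem_stabilizer_iff]
    exact (IntermediateField.mem_fixingSubgroup_iff _ _).mp hg ζ
      (IntermediateField.mem_adjoin_simple_self K ζ)
  -- some layer of `D_𝔭` fixes `ζ`
  obtain ⟨n, hn⟩ := exists_layerSubgroup_inf_subset κ (decomp 𝔭) (Literature.NumberTheory.EllipticCurves.ZpExtension.isClosed_decomp 𝔭) hVopen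
    (fun g hg ↦ by
      show g ∈ (V : Set (absoluteGaloisGroup K))
      rw [SetLike.mem_coe, MulAction.mem_stabilizer_iff]
      exact hHζ g hg)
  -- hence `D_𝔭` fixes `ζ`
  have hDζ : ∀ d ∈ decomp 𝔭, d • ζ = ζ := by
    intro d hd
    -- `d ζ = ζ^a`
    have hdp : (d • ζ) ^ p = 1 := by rw [← smul_pow', hζp, smul_one]
    obtain ⟨a, -, ha⟩ := hζprim.eq_pow_of_pow_eq_one hdp
    -- `d^k ζ = ζ^(a^k)`
    have hiter : ∀ k : ℕ, d ^ k • ζ = ζ ^ (a ^ k) := by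
      intro k
      induction k with
      | zero => rw [pow_zero, one_smul, pow_zero, pow_one]
      | succ k ih => rw [pow_succ, mul_smul, ← ha, smul_pow', ih, ← pow_mul, ← pow_succ]
    -- `d^(p^n)` fixes `ζ`
    have hfix : d ^ (p ^ n) • ζ = ζ := by
      have hmem : d ^ (p ^ n) ∈ decomp 𝔭 ⊓ κ.layerSubgroup n :=
        Subgroup.mem_inf.mpr ⟨(decomp 𝔭).pow_mem hd _, pow_prime_pow_mem_layerSubgroup κ d n⟩
      have := hn _ hmem
      rw [SetLike.mem_coe, MulAction.mem_stabilizer_iff] at this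
      exact this
    rw [hiter] at hfix
    -- Fermat: `a^(p^n) ≡ a (mod p)`, so `ζ^a = ζ^(a^(p^n)) = ζ`
    have hF' : ∀ k : ℕ, (a : ZMod p) ^ (p ^ k) = (a : ZMod p) := by
      intro k
      induction k with
      | zero => rw [pow_zero, pow_one]
      | succ k ih => rw [pow_succ, pow_mul, ih, ZMod.pow_card]
    have hF : a ^ (p ^ n) ≡ a [MOD p] := by
      rw [← ZMod.natCast_eq_natCast_iff, Nat.cast_pow]
      exact hF' n
    have hle : a ≤ a ^ (p ^ n) := by
      rcases Nat.eq_zero_or_pos a with rfl | hapos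
      · simp
      · exact Nat.le_self_pow (pow_ne_zero n hpr.ne_zero) a
    obtain ⟨t, ht⟩ := (Nat.modEq_iff_dvd' hle).mp hF.symm
    have hdecomp : a ^ (p ^ n) = a + p * t := by omega
    rw [← ha]
    calc ζ ^ a = ζ ^ a * (ζ ^ p) ^ t := by rw [hζp, one_pow, mul_one]
      _ = ζ ^ (a ^ (p ^ n)) := by rw [hdecomp, pow_add, pow_mul]
      _ = ζ := hfix
  -- so `Γ_{K_𝔭}` fixes `ι ζ`, i.e. `ι ζ ∈ K_𝔭`
  set L := 𝔭.adicCompletion K with hL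
  haveI : CharZero L := charZero_of_injective_algebraMap (algebraMap K L).injective
  haveI : IsGalois L (AlgebraicClosure L) :=
    @IsAlgClosure.isGalois L (AlgebraicClosure L) _ _ (AlgebraicClosure.instAlgebra L) inferInstance
      inferInstance
  set ι := absClosureEmbedding K L with hι
  have hfixι : ∀ σ : (AlgebraicClosure L ≃ₐ[L] AlgebraicClosure L), σ (ι ζ) = ι ζ := fun σ ↦ by
    have h := absGaloisRestrict_apply_smul K L σ ζ
    have hd : (absGaloisRestrict K L σ : absoluteGaloisGroup K) ∈ decomp 𝔭 := ⟨σ, rfl⟩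
    have h2 : absGaloisRestrict K L σ • ζ = ζ := hDζ _ hd
    rw [h2] at h
    rw [← hι] at h
    exact h.symm
  obtain ⟨z, hz⟩ := (InfiniteGalois.mem_range_algebraMap_iff_fixed (ι ζ)).mpr hfixι
  -- `z` is a primitive `p`-th root of unity in `K_𝔭`
  have hιζ : IsPrimitiveRoot (ι ζ) p := hζprim.map_of_injective ι.toRingHom.injective
  rw [← hz] at hιζ
  exact hμ z (hιζ.of_map_of_injective (algebraMap L (AlgebraicClosure L)).injective)

end Literature.NumberTheory.EllipticCurves.IwasawaTowerTorsion.WeierstrassCurve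

end Part6

/-!
## Part 7 — port of `Summits/BirchSwinnertonDyer/BirchSwinnertonDyer/Theorems/KatoDescentPotSupersingularTowerTorsionFinite.lean` (4 declarations kept)

# Imai's finiteness `W(ℚ_{p,∞})[p^∞] < ∞` on every potentially supersingular row, in the local and in the number-field dialect

Declarations of this Part (verbatim port; each keeps its own docstring and citation): `noStableDivisibleLine_of_eq`, `baseChange_rat_eq`, `exists_pTorsion_not_fixed_rat`, `finite_fixedPoints_kerSubgroup_inf_decomp_of_potentiallySupersingular`.

Reference keys (see `references.bib` and the declarations' citations): [SilvermanAEC2009], [Serre1973], [Serre1967GroupesPDivisibles], [Imai1975], [GreenbergLNM1716].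
-/

section Part7

open scoped _root_.Classical _root_.NumberField
open _root_.Function _root_.Field _root_.NumberField _root_.IsDedekindDomain _root_.WeierstrassCurve
open Literature.NumberTheory.EllipticCurves Literature.NumberTheory.EllipticCurves.GreenbergSelmer
open Literature.NumberTheory.GaloisRepresentations
open Literature.NumberTheory.EllipticCurves.IwasawaTowerTorsion
open Literature.NumberTheory.EllipticCurves.IwasawaTowerTorsion

namespace Literature.NumberTheory.EllipticCurves.IwasawaTowerTorsion.Finite

/-- Transport of the «no stable divisible line» statement along an EQUALITY of Weierstrass curves (used for
`W.baseChange ℚ = W`). [folklore] -/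
private theorem noStableDivisibleLine_of_eq {K : Type} [Field K] [NumberField K] {E E' : WeierstrassCurve K}
    (h : E = E') (p : ℕ) (𝔭 : HeightOneSpectrum (𝓞 K))
    (hE : ∀ N : AddSubgroup (E.geomPrimaryTorsion p),
      (∀ d ∈ decomp 𝔭, ∀ c ∈ N, d • c ∈ N) → (∀ c ∈ N, ∃ c' ∈ N, p • c' = c) →
      Set.ncard {c : E.geomPrimaryTorsion p | c ∈ N ∧ p • c = 0} ≤ p → N = ⊥) :
    ∀ N : AddSubgroup (E'.geomPrimaryTorsion p),
      (∀ d ∈ decomp 𝔭, ∀ c ∈ N, d • c ∈ N) → (∀ c ∈ N, ∃ c' ∈ N, p • c' = c) →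
      Set.ncard {c : E'.geomPrimaryTorsion p | c ∈ N ∧ p • c = 0} ≤ p → N = ⊥ := by
  subst h
  exact hE

/-- `W.baseChange ℚ = W` (the `ℚ`-algebra structure of `ℚ` is the identity; `WeierstrassCurve.map_id`). [cite: SilvermanAEC2009, Cor. III.8.1.1] -/
theorem baseChange_rat_eq (W : WeierstrassCurve ℚ) : W.baseChange ℚ = W := by
  change W.map (algebraMap ℚ ℚ) = W
  rw [Subsingleton.elim (algebraMap ℚ ℚ) (RingHom.id ℚ), WeierstrassCurve.map_id]

/-- **At the place `v` of `ℚ` above an ODD `p`, the local tower group `D_v ⊓ ker κ` of ANY `ℤ_p`-extension moves a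
`p`-torsion point of `E(ℚ̄)`** (`ℚ_v ≃ ℚ_p` has no primitive `p`-th root of unity for `p` odd; Weil pairing — kmc g16's
`exists_pTorsion_not_fixed_of_no_primitiveRoot` at `K = ℚ`). [cite: SilvermanAEC2009, Cor. III.8.1.1]
[cite: Serre1973, Ch. II §3.1 Prop. 7] -/
theorem exists_pTorsion_not_fixed_rat (W : WeierstrassCurve ℚ) [W.IsElliptic] (p : ℕ) [Fact p.Prime]
    (hp2 : p ≠ 2) (κ : ZpExtension ℚ p) (v : HeightOneSpectrum (𝓞 ℚ))
    (hv : ((Rat.HeightOneSpectrum.primesEquiv v : Nat.Primes) : ℕ) = p) :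
    ∃ m : W.geomPrimaryTorsion p, p • m = 0 ∧ ∃ g ∈ decomp v ⊓ κ.kerSubgroup, g • m ≠ m := by
  subst hv
  have hpr : ((Rat.HeightOneSpectrum.primesEquiv v : Nat.Primes) : ℕ).Prime := Fact.out
  refine Literature.NumberTheory.EllipticCurves.IwasawaTowerTorsion.WeierstrassCurve.exists_pTorsion_not_fixed_of_no_primitiveRoot W _ κ v fun z hz ↦ ?_
  set e : v.adicCompletion ℚ →ₐ[ℚ] ℚ_[((Rat.HeightOneSpectrum.primesEquiv v : Nat.Primes) : ℕ)] :=
    (Rat.HeightOneSpectrum.adicCompletion.padicEquiv (R := 𝓞 ℚ) v).toAlgEquiv.toAlgHom with he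
  have hinj : Function.Injective e :=
    (Rat.HeightOneSpectrum.adicCompletion.padicEquiv (R := 𝓞 ℚ) v).toAlgEquiv.injective
  have hz' : IsPrimitiveRoot (e z) _ := hz.map_of_injective hinj
  have hdvd := (Literature.AnabelianGeometry.EtaleTheta.exists_isPrimitiveRoot_padic_iff_dvd_pred _ hp2
    hpr.ne_zero).mp ⟨e z, hz'⟩
  have hle := Nat.le_of_dvd (by have := hpr.two_le; omega) hdvd
  have := hpr.two_le
  omega

/-- **Imai's finiteness at a potentially SUPERSINGULAR odd prime, `ℚ`-level dialect, EVERY `ℤ_p`-extension.**  For an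
elliptic curve `W/ℚ`, an odd prime `p` with `0 ≤ ord_p j(W)` such that the unit-root condition FAILS at every place of
good reduction above `p` of every number field (potentially supersingular reduction), every `ℤ_p`-extension `κ` of `ℚ`
and the place `v` of `ℚ` at `p`: the points of `W(ℚ̄)[p^∞]` fixed by `ker κ ⊓ D_v` — `W(ℚ_{∞,v})[p^∞]` — form a FINITE
group.  VERBATIM the conclusion of the Imai fact `imai1975_finite_fixedPoints_kerSubgroup_inf_decomp_of_padicValRat_j_nonneg`
and the hypothesis `hfin` of `Kato2004.exists_iwasawaH2Data_fineSelmerDual_embedding{,_count}` on these rows.  Proof: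
kmc's line-free reduction at `K = ℚ`, `E = W`, with (i) no `D_v`-stable divisible line (Serre 1967 Prop. 8, tree
theorem, read through `W.baseChange ℚ = W`) and (ii) a `p`-torsion point moved by the tower group (`μ_p ⊄ ℚ_p`).
[cite: Serre1967GroupesPDivisibles, §5 Prop. 8] [cite: Imai1975, Theorem (p. 12)]
[cite: GreenbergLNM1716, §3 Lemma 3.3 (p. 87)] -/
theorem finite_fixedPoints_kerSubgroup_inf_decomp_of_potentiallySupersingular
    (W : WeierstrassCurve ℚ) [W.IsElliptic] (p : ℕ) [Fact p.Prime] (hp2 : p ≠ 2)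
    (hj : 0 ≤ padicValRat p W.j)
    (hss : ∀ (F : Type) [Field F] [NumberField F] (w : HeightOneSpectrum (𝓞 F)),
      ((p : ℕ) : 𝓞 F) ∈ w.asIdeal → (W.baseChange F).HasGoodReductionAt w →
        ¬ (W.baseChange F).HasUnitRootAt w)
    (κ : ZpExtension ℚ p) (v : HeightOneSpectrum (𝓞 ℚ))
    (hv : ((Rat.HeightOneSpectrum.primesEquiv v : Nat.Primes) : ℕ) = p) :
    Finite (FixedPoints.addSubgroup ↥(κ.kerSubgroup ⊓ decomp v) (W.geomPrimaryTorsion p)) := by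
  have hpr : p.Prime := Fact.out
  have hpv : ((p : ℕ) : 𝓞 ℚ) ∈ v.asIdeal :=
    (natCast_mem_asIdeal_iff_eq_primesEquiv_symm v hpr).mpr
      ((Equiv.eq_symm_apply _).mpr (Subtype.ext hv))
  -- (i) no stable divisible line: Serre 1967 Prop. 8 at `K = ℚ`, read through `W.baseChange ℚ = W`
  have hline := noStableDivisibleLine_of_eq (baseChange_rat_eq W) p v
    (Serre1967.noStableDivisibleLine_of_potentiallySupersingular_holds W p hj hss ℚ v hpv)
  -- (ii) the tower group moves a `p`-torsion point; then kmc's line-free reduction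
  have hfin := Literature.NumberTheory.EllipticCurves.IwasawaTowerTorsion.WeierstrassCurve.localTowerTorsionFiniteAt_of_noStableDivisibleLine W p κ v hline
    (exists_pTorsion_not_fixed_rat W p hp2 κ v hv)
  rw [inf_comm]
  exact hfin.to_subtype

end Literature.NumberTheory.EllipticCurves.IwasawaTowerTorsion.Finite

end Part7

/-!
## Part 8 — port of `Summits/BirchSwinnertonDyer/Rank1Residual/X11b/KolyvaginFrobeniusEigenparts.lean` (2 declarations kept)

# The `±`-eigen `p`-parts of `Ẽ(𝔽_{ℓ²})` under `Frob_ℓ` are cyclic of order exactly `p^{v_p(ℓ+1∓a_ℓ)}`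

Declarations of this Part (verbatim port; each keeps its own docstring and citation): `natCard_torsionBy_pow_succ_le`, `natCard_torsionBy_pow_le`.

Reference keys (see `references.bib` and the declarations' citations): [Imai1975].
-/

section Part8

open scoped _root_.Classical
open _root_.WeierstrassCurve _root_.Field
open Literature.NumberTheory.EllipticCurves

namespace Literature.NumberTheory.EllipticCurves.IwasawaTowerTorsion.TorsionCount

section Cyclic

variable {G : Type*} [AddCommGroup G] [Finite G] {p : ℕ} [hp : Fact p.Prime]

omit hp in
/-- `#G[p^(j+1)] ≤ #G[p^j] · #G[p]`: multiplication by `p` maps `G[p^(j+1)]` to `G[p^j]` with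
kernel inside `G[p]`. [cite: Imai1975, Theorem (supporting lemma)] -/
theorem natCard_torsionBy_pow_succ_le (j : ℕ) :
    Nat.card (AddSubgroup.torsionBy G ((p : ℤ) ^ (j + 1))) ≤
      Nat.card (AddSubgroup.torsionBy G ((p : ℤ) ^ j)) * Nat.card (AddSubgroup.torsionBy G (p : ℤ)) := by
  set H := AddSubgroup.torsionBy G ((p : ℤ) ^ (j + 1)) with hH
  have hmem : ∀ {n : ℤ} {x : G}, x ∈ AddSubgroup.torsionBy G n ↔ n • x = 0 := by
    intro n x
    rw [AddSubgroup.torsionBy, Submodule.mem_toAddSubgroup, Submodule.mem_torsionBy_iff]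
  -- multiplication by `p` on `H`
  set f : H →+ G := (zsmulAddGroupHom (p : ℤ) : G →+ G).comp H.subtype with hf
  have hf_apply : ∀ x : H, f x = (p : ℤ) • (x : G) := fun x ↦ rfl
  have hrange : f.range ≤ AddSubgroup.torsionBy G ((p : ℤ) ^ j) := by
    rintro _ ⟨x, rfl⟩
    rw [hmem, hf_apply, smul_smul, ← pow_succ, ← hmem]
    exact x.2
  have hker : Function.Injective (fun x : f.ker ↦ (⟨(x : H), by
      rw [hmem]
      have := x.2
      rwa [AddMonoidHom.mem_ker, hf_apply] at this⟩ : AddSubgroup.torsionBy G (p : ℤ))) := by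
    intro x y h
    apply Subtype.ext; apply Subtype.ext
    have h' := congrArg (fun z : AddSubgroup.torsionBy G (p : ℤ) ↦ (z : G)) h
    simpa using h'
  calc Nat.card H = Nat.card (H ⧸ f.ker) * Nat.card f.ker :=
        AddSubgroup.card_eq_card_quotient_mul_card_addSubgroup _
    _ = Nat.card f.range * Nat.card f.ker := by
        rw [Nat.card_congr (QuotientAddGroup.quotientKerEquivRange f).toEquiv]
    _ ≤ Nat.card (AddSubgroup.torsionBy G ((p : ℤ) ^ j)) *
          Nat.card (AddSubgroup.torsionBy G (p : ℤ)) :=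
        Nat.mul_le_mul (AddSubgroup.card_le_of_le hrange) (Nat.card_le_card_of_injective _ hker)

omit hp in
/-- `#G[p^j] ≤ p^j` when `#G[p] ≤ p`. [cite: Imai1975, Theorem (supporting lemma)] -/
theorem natCard_torsionBy_pow_le (h1 : Nat.card (AddSubgroup.torsionBy G (p : ℤ)) ≤ p) (j : ℕ) :
    Nat.card (AddSubgroup.torsionBy G ((p : ℤ) ^ j)) ≤ p ^ j := by
  induction j with
  | zero =>
    rw [pow_zero, pow_zero]
    have : AddSubgroup.torsionBy G (1 : ℤ) = ⊥ := by
      ext x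
      rw [AddSubgroup.torsionBy, Submodule.mem_toAddSubgroup, Submodule.mem_torsionBy_iff, one_smul,
        AddSubgroup.mem_bot]
    rw [this, AddSubgroup.card_bot]
  | succ j ih =>
    calc _ ≤ _ := natCard_torsionBy_pow_succ_le j
      _ ≤ p ^ j * p := Nat.mul_le_mul ih h1
      _ = p ^ (j + 1) := (pow_succ p j).symm

end Cyclic

end Literature.NumberTheory.EllipticCurves.IwasawaTowerTorsion.TorsionCount

end Part8

/-!
## Part 9 — port of `Summits/BirchSwinnertonDyer/BirchSwinnertonDyer/Theorems/KatoDescentPotSupersingularTowerTorsionOrdinaryLocal.lean` (3 declarations kept)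

# The local ordinary lemma behind Imai's finiteness (the unit-root line is the only candidate stable divisible line), and the line-free reduction

Declarations of this Part (verbatim port; each keeps its own docstring and citation): `exists_mem_addOrderOf_eq_pow`, `exists_fixing_rootsOfUnity_forall_eq_bot_of_hasUnitRootAt`, `localTowerTorsionFiniteAt_of_noFixedStableDivisibleLine`.

Reference keys (see `references.bib` and the declarations' citations): [Imai1975], [SerreInventiones1972], [SilvermanAEC2009], [GreenbergLNM1716].
-/

section Part9

open scoped _root_.Classical _root_.NumberField AddSubgroup
open _root_.Function _root_.Field _root_.NumberField _root_.IsDedekindDomain _root_.WeierstrassCurve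
open Literature.NumberTheory.EllipticCurves Literature.NumberTheory.EllipticCurves.GreenbergSelmer
open Literature.NumberTheory.GaloisRepresentations
open Literature.NumberTheory.EllipticCurves.IwasawaTowerTorsion.LocalTowerTorsionLine
open Literature.NumberTheory.EllipticCurves.IwasawaTowerTorsion

universe u

namespace Literature.NumberTheory.EllipticCurves.IwasawaTowerTorsion.FiniteOrdinary

/-! ## §4 The local ordinary lemma: a `p`-divisible subgroup of `E(F̄)` fixed by `ι·Frob_w^e` is zero -/

/-- Points of every order `p^k` in a non-zero `p`-primary `p`-divisible subgroup of `E(F̄)`. [cite: Imai1975, Theorem (p. 12)] -/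
theorem exists_mem_addOrderOf_eq_pow {F : Type} [Field F] [NumberField F] (E : WeierstrassCurve F) [E.IsElliptic]
    (p : ℕ) [hp : Fact p.Prime] (N : AddSubgroup (geomPoints E)) (hprim : ∀ c ∈ N, ∃ k : ℕ, p ^ k • c = 0)
    (hdiv : ∀ c ∈ N, ∃ c' ∈ N, p • c' = c) (hbot : N ≠ ⊥) (k : ℕ) :
    ∃ c ∈ N, addOrderOf c = p ^ k := by
  set M : AddSubgroup (geomPoints E) := E.geomPrimaryTorsion p with hM
  set C : AddSubgroup M := N.comap M.subtype with hC
  have htorM : ∀ x : M, ∃ k : ℕ, p ^ k • x = 0 := fun x ↦ by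
    obtain ⟨k, hk⟩ := x.2
    exact ⟨k, Subtype.ext (by rw [AddSubgroupClass.coe_nsmul, hk]; rfl)⟩
  have hmemM : ∀ c ∈ N, c ∈ M := fun c hc ↦ by
    obtain ⟨k, hk⟩ := hprim c hc
    exact ⟨k, hk⟩
  have hCdiv : ∀ c ∈ C, ∃ c' ∈ C, p • c' = c := by
    intro c hc
    rw [hC, AddSubgroup.mem_comap] at hc
    obtain ⟨c', hc', hpc'⟩ := hdiv _ hc
    refine ⟨⟨c', hmemM c' hc'⟩, ?_, Subtype.ext ?_⟩
    · rw [hC, AddSubgroup.mem_comap]; exact hc'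
    · rw [AddSubgroupClass.coe_nsmul]; exact hpc'
  have hCbot : C ≠ ⊥ := by
    intro hCb
    apply hbot
    rw [eq_bot_iff]
    intro c hc
    have h : (⟨c, hmemM c hc⟩ : M) ∈ C := by rw [hC, AddSubgroup.mem_comap]; exact hc
    rw [hCb, AddSubgroup.mem_bot] at h
    rw [AddSubgroup.mem_bot]
    exact congrArg Subtype.val h
  obtain ⟨c, hcC, hcord⟩ :=
    LocalTowerTorsionLine.exists_addOrderOf_eq_pow_of_divisible_of_ne_bot C htorM hCdiv hCbot k
  refine ⟨(c : geomPoints E), (AddSubgroup.mem_comap.mp hcC), ?_⟩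
  rw [← hcord]
  exact addOrderOf_injective M.subtype Subtype.coe_injective c

/-- **The local ordinary lemma.**  Let `E/F` be an elliptic curve over a number field, `p` a prime and `w ∣ p` a place of
GOOD ORDINARY reduction (`HasGoodReductionAt`, `HasUnitRootAt`).  There is `γ ∈ Γ_{F_w}` FIXING EVERY `p`-POWER ROOT OF
UNITY of `F̄_w` — `γ = ι·σ_w^e` with `σ_w` an arithmetic Frobenius, `ι` an inertia element and `e = e(w ∣ p)`
(`exists_forall_exists_mem_inertia_mul_pow_smul_rootOfUnity_eq`) — such that every `p`-primary, `p`-DIVISIBLE subgroup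
`N ≤ E(F̄)` fixed pointwise by `γ` (through `Γ_{F_w} → Γ_F`) is ZERO.  Proof, with the reduction map `f : E(F̄) → Ẽ_w(k̄_w)`
of `exists_goodReductionHom_frobenius` (inertia-invariant, `f(σ_w a) = φ_w f(a)`, `#(ker f ∩ E[p]) = p`): `f(N)` is fixed by
`φ_w^e`, hence finite (`Ẽ_w(𝔽_{q^e})`), so `N ≤ ker f` (divisible with finite image); if `N ≠ 0` it has a point `P` of order
`p^n` for every `n`, and the Weil pairing gives `γR - R ∈ ℤ·P ⊆ ker f` for all `R ∈ E[p^n]`, i.e. `φ_w^e` fixes `f(E[p^n])`,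
a set of size `≥ p^{2n}/p^n = p^n` — unbounded in the finite `Ẽ_w(𝔽_{q^e})`.  NO unit-root eigenvalue, NO weight argument.
[cite: Imai1975, Theorem (p. 12)] [cite: SerreInventiones1972, §1.11 Prop. 11] [cite: SilvermanAEC2009, Prop. III.8.1, VII.§2]
[cite: GreenbergLNM1716, §1 p. 62 and §2 p. 70] -/
theorem exists_fixing_rootsOfUnity_forall_eq_bot_of_hasUnitRootAt {F : Type} [Field F] [NumberField F]
    (E : WeierstrassCurve F) [E.IsElliptic] (p : ℕ) [hp : Fact p.Prime] (w : HeightOneSpectrum (𝓞 F))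
    (hpw : (p : 𝓞 F) ∈ w.asIdeal) (hgood : E.HasGoodReductionAt w) (hunit : E.HasUnitRootAt w) :
    ∃ γ : absoluteGaloisGroup (w.adicCompletion F),
      (∀ (k : ℕ) (ξ : AlgebraicClosure (w.adicCompletion F)), ξ ^ p ^ k = 1 → γ • ξ = ξ) ∧
      (∀ (k : ℕ) (ξ : AlgebraicClosure F), ξ ^ p ^ k = 1 → absGaloisRestrict F (w.adicCompletion F) γ • ξ = ξ) ∧
      ∀ N : AddSubgroup (geomPoints E), (∀ c ∈ N, ∃ k : ℕ, p ^ k • c = 0) →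
        (∀ c ∈ N, ∃ c' ∈ N, p • c' = c) →
        (∀ c ∈ N, absGaloisRestrict F (w.adicCompletion F) γ • c = c) → N = ⊥ := by
  have hpp : p.Prime := hp.out
  have hpF : (p : F) ≠ 0 := Nat.cast_ne_zero.mpr hpp.ne_zero
  -- Frobenius data at `w` and the reduction map
  obtain ⟨𝔐, h𝔐⟩ := w.localPrimesAbove_nonempty
  obtain ⟨σF, hσF⟩ := w.exists_isArithFrobAt_localAbsIntegers h𝔐
  haveI : Finite (IsLocalRing.ResidueField (w.adicCompletionIntegers F)) :=
    IsDedekindDomain.HeightOneSpectrum.finite_residueField_adicCompletionIntegers F w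
  obtain ⟨φ, hφ⟩ := exists_frobenius_absoluteGaloisGroup (IsLocalRing.ResidueField (w.adicCompletionIntegers F))
  have hord : ¬ ((p : ℤ) ∣ E.frobeniusTraceAt w) := by
    have h : ¬ ((ringChar (IsLocalRing.ResidueField (w.adicCompletionIntegers F)) : ℤ) ∣ E.frobeniusTraceAt w) := hunit
    rwa [WeierstrassCurve.ringChar_residueField_eq w hpp hpw] at h
  obtain ⟨f, -, hI, hF, hK⟩ := exists_goodReductionHom_frobenius E p w hpw hgood hord h𝔐 hσF hφ
  -- the element `γ = ι σ_w^e` fixing `μ_{p^∞}` (the ramified cyclotomic lemma)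
  obtain ⟨wv, hwv⟩ := w.exists_spectralValuation
  obtain ⟨e, he1, hγ⟩ :=
    IsDedekindDomain.HeightOneSpectrum.exists_forall_exists_mem_inertia_mul_pow_smul_rootOfUnity_eq hwv h𝔐 hpw
  obtain ⟨ι, hι, hfix⟩ := hγ σF
  set res := absGaloisRestrict F (w.adicCompletion F) with hres
  -- `res γ` fixes the `p`-power roots of unity of `F̄`
  have hresfix : ∀ (k : ℕ) (ξ : AlgebraicClosure F), ξ ^ p ^ k = 1 → res (ι * σF ^ e) • ξ = ξ := by
    intro k ξ hξ
    apply (closureEmb (K := F) (w.adicCompletion F)).toRingHom.injective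
    have h1 : closureEmb (K := F) (w.adicCompletion F) (res (ι * σF ^ e) • ξ) =
        (ι * σF ^ e) • closureEmb (K := F) (w.adicCompletion F) ξ := by
      rw [hres, ← WeierstrassCurve.resGal_eq_absGaloisRestrict, resGal_eq]
      exact apply_resGalAuxOfEmb_apply _ _ ξ
    change closureEmb (K := F) (w.adicCompletion F) (res (ι * σF ^ e) • ξ) = closureEmb (K := F) (w.adicCompletion F) ξ
    rw [h1]
    exact hfix k _ (by rw [← map_pow, hξ, map_one])
  refine ⟨ι * σF ^ e, hfix, hresfix, ?_⟩
  intro N hprim hdiv hNfix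
  -- `f (res γ • a) = φ^e • f a`
  have hιabs : ι ∈ absInertia (w.adicCompletion F) := by
    rw [← IsDedekindDomain.HeightOneSpectrum.inertia_eq_absInertia hwv h𝔐]; exact hι
  have hFpow : ∀ (n : ℕ) (a : geomPoints E), f (res (σF ^ n) • a) = φ ^ n • f a := by
    intro n
    induction n with
    | zero => intro a; rw [pow_zero, map_one, one_smul, pow_zero, one_smul]
    | succ n ih => intro a; rw [pow_succ, map_mul, mul_smul, ih, hF, ← mul_smul, ← pow_succ]
  have hγf : ∀ a : geomPoints E, f (res (ι * σF ^ e) • a) = φ ^ e • f a := by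
    intro a
    rw [map_mul, mul_smul, hI ι hιabs, hFpow]
  -- the image of `N` is fixed by `φ^e`, hence finite; so `N ≤ ker f`
  have hfinS := finite_setOf_frobenius_pow_smul_eq (E.reductionAt w) hφ he1
  have hNker : N ≤ f.ker := by
    refine le_ker_of_divisible_of_finite_map f p N hprim hdiv (hfinS.subset ?_)
    rintro _ ⟨c, hc, rfl⟩
    change φ ^ e • f c = f c
    rw [← hγf, hNfix c hc]
  -- finiteness of `ker f ∩ E[m]`
  have hfinI : ∀ m : ℕ, m ≠ 0 → Finite ↥(f.ker ⊓ geomTorsion E (m : ℤ)) := by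
    intro m hm
    haveI : Finite (geomTorsion E (m : ℤ)) := E.finite_torsionPoints_holds (AlgebraicClosure F) (by exact_mod_cast hm)
    refine Finite.of_injective (fun x : ↥(f.ker ⊓ geomTorsion E (m : ℤ)) ↦
      (⟨(x : geomPoints E), (AddSubgroup.mem_inf.mp x.2).2⟩ : geomTorsion E (m : ℤ))) ?_
    intro x y hxy
    have h := congrArg Subtype.val hxy
    exact Subtype.ext h
  -- suppose `N ≠ ⊥`
  by_contra hNbot
  -- the size of `ker f ∩ E[p^n]` is at most `p^n`
  have hkerle : ∀ n : ℕ, Nat.card ↥(f.ker ⊓ geomTorsion E ((p ^ n : ℕ) : ℤ)) ≤ p ^ n := by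
    intro n
    haveI : Finite ↥(f.ker ⊓ geomTorsion E ((p : ℕ) : ℤ)) := hfinI p hpp.ne_zero
    set G : AddSubgroup (geomPoints E) := f.ker ⊓ geomTorsion E ((p ^ n : ℕ) : ℤ) with hG
    haveI : Finite G := hfinI (p ^ n) (pow_ne_zero n hpp.ne_zero)
    -- `#G[p] ≤ p`
    have h1 : Nat.card (AddSubgroup.torsionBy G (p : ℤ)) ≤ p := by
      refine le_trans (Nat.card_le_card_of_injective (fun x ↦ (⟨((x : G) : geomPoints E), AddSubgroup.mem_inf.mpr
        ⟨(AddSubgroup.mem_inf.mp (x : G).2).1, ?_⟩⟩ : ↥(f.ker ⊓ geomTorsion E ((p : ℕ) : ℤ)))) ?_) hK.le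
      · have hx : (p : ℤ) • (x : G) = 0 := mem_torsionBy_iff.mp x.2
        rw [mem_geomTorsion_iff]
        have h := congrArg (fun y : G ↦ (y : geomPoints E)) hx
        simpa only [AddSubgroupClass.coe_zsmul, ZeroMemClass.coe_zero] using h
      · intro x y hxy
        have h := congrArg Subtype.val hxy
        exact Subtype.ext (Subtype.ext h)
    -- `G = G[p^n]`
    have h2 : Nat.card G = Nat.card (AddSubgroup.torsionBy G ((p : ℤ) ^ n)) := by
      have htop : AddSubgroup.torsionBy G ((p : ℤ) ^ n) = ⊤ := by
        rw [eq_top_iff]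
        intro x _
        rw [AddSubgroup.torsionBy, Submodule.mem_toAddSubgroup, Submodule.mem_torsionBy_iff]
        apply Subtype.ext
        have hx : ((p ^ n : ℕ) : ℤ) • ((x : G) : geomPoints E) = 0 :=
          (mem_geomTorsion_iff E _ _).mp (AddSubgroup.mem_inf.mp x.2).2
        rw [AddSubgroupClass.coe_zsmul, ZeroMemClass.coe_zero, ← hx, Nat.cast_pow]
      rw [htop, AddSubgroup.card_top]
    rw [h2]
    exact Literature.NumberTheory.EllipticCurves.IwasawaTowerTorsion.TorsionCount.natCard_torsionBy_pow_le h1 n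
  -- `φ^e` fixes `f(E[p^n])` for every `n`
  have hfixE : ∀ (n : ℕ) (R : geomPoints E), R ∈ geomTorsion E ((p ^ n : ℕ) : ℤ) → φ ^ e • f R = f R := by
    intro n R hR
    obtain ⟨P, hPN, hPord⟩ := exists_mem_addOrderOf_eq_pow E p N hprim hdiv hNbot n
    have hmem := smul_sub_mem_zmultiples_of_fixing_rootsOfUnity E hpp hpF hresfix hPord (hNfix P hPN) hR
    have hker : res (ι * σF ^ e) • R - R ∈ f.ker :=
      (AddSubgroup.zmultiples_le_of_mem (hNker hPN)) hmem
    rw [AddMonoidHom.mem_ker, map_sub, sub_eq_zero, hγf] at hker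
    exact hker
  -- counting: `p^n ≤ #f(E[p^n]) ≤ #Fix(φ^e)` for all `n`
  set S := hfinS.toFinset with hSdef
  obtain ⟨n, hn⟩ : ∃ n : ℕ, S.card < p ^ n := ⟨S.card, Nat.lt_pow_self hpp.one_lt⟩
  haveI hfinT : Finite (geomTorsion E ((p ^ n : ℕ) : ℤ)) :=
    E.finite_torsionPoints_holds (AlgebraicClosure F) (by exact_mod_cast pow_ne_zero n hpp.ne_zero)
  haveI : Finite ↥(f.ker ⊓ geomTorsion E ((p ^ n : ℕ) : ℤ)) := hfinI (p ^ n) (pow_ne_zero n hpp.ne_zero)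
  -- restrict `f` to `E[p^n]`
  set fn : geomTorsion E ((p ^ n : ℕ) : ℤ) →+ geomPoints (E.reductionAt w) := f.comp (geomTorsion E ((p ^ n : ℕ) : ℤ)).subtype
    with hfn
  have hcardT : Nat.card (geomTorsion E ((p ^ n : ℕ) : ℤ)) = p ^ (2 * n) :=
    card_geomTorsion_pow_eq E p (card_torsionPoints_eq_sq_holds E (AlgebraicClosure F)) hpF n
  have hkerfn : Nat.card fn.ker ≤ p ^ n := by
    refine le_trans (Nat.card_le_card_of_injective (fun x : fn.ker ↦ (⟨((x : geomTorsion E ((p ^ n : ℕ) : ℤ)) : geomPoints E),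
      AddSubgroup.mem_inf.mpr ⟨?_, (x : geomTorsion E ((p ^ n : ℕ) : ℤ)).2⟩⟩ : ↥(f.ker ⊓ geomTorsion E ((p ^ n : ℕ) : ℤ)))) ?_)
      (hkerle n)
    · have hx := x.2
      rw [AddMonoidHom.mem_ker] at hx
      exact hx
    · intro x y hxy
      have h := congrArg Subtype.val hxy
      exact Subtype.ext (Subtype.ext h)
  have hrange : p ^ n ≤ Nat.card fn.range := by
    have h1 : Nat.card fn.ker * Nat.card fn.range = p ^ (2 * n) := by
      rw [← AddSubgroup.index_ker, AddSubgroup.card_mul_index, hcardT]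
    by_contra hlt
    push Not at hlt
    have h2 : Nat.card fn.ker * Nat.card fn.range < p ^ n * p ^ n :=
      Nat.mul_lt_mul_of_le_of_lt hkerfn hlt (pow_pos hpp.pos n)
    rw [h1, ← pow_add, show n + n = 2 * n by ring] at h2
    exact lt_irrefl _ h2
  -- `range fn ⊆ S`
  have hsub : (fn.range : Set (geomPoints (E.reductionAt w))) ⊆ (S : Set (geomPoints (E.reductionAt w))) := by
    rintro _ ⟨x, rfl⟩
    rw [hSdef, Set.Finite.coe_toFinset]
    exact hfixE n x x.2
  have hle : Nat.card fn.range ≤ S.card := by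
    have h1 : Nat.card ↥((fn.range : Set (geomPoints (E.reductionAt w)))) ≤
        Nat.card ↥((S : Set (geomPoints (E.reductionAt w)))) := Nat.card_mono S.finite_toSet hsub
    rw [Finset.coe_sort_coe, Nat.card_eq_finsetCard] at h1
    exact h1
  omega

/-! ## §5 Fin_v without a FIXED line (the kmc line-free reduction, keeping «fixed by the tower group») -/

/-- **Fin_v from the absence of a `D_𝔭`-stable divisible line FIXED POINTWISE by the local tower group.**  As
`IwasawaTowerTorsion.WeierstrassCurve.localTowerTorsionFiniteAt_of_noStableDivisibleLine`: for an elliptic `E/K`, a prime `p`, a `ℤ_p`-extension `κ` and a finite place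
`𝔭`, IF (i′) every `D_𝔭`-stable `p`-divisible subgroup `N ≤ E(K̄)[p^∞]` with `#N[p] ≤ p` that is moreover FIXED POINTWISE by
`D_𝔭 ⊓ ker κ` is zero, and (ii) some `p`-torsion point is moved by `D_𝔭 ⊓ ker κ`, THEN the `p`-primary torsion fixed by
`D_𝔭 ⊓ ker κ` is finite.  (At a potentially ORDINARY prime there ARE stable divisible lines — the kernel of reduction — so
kmc's (i) fails; (i′) is what the ordinary argument of §4 supplies.)  The fixed module `B` is `D_𝔭`-stable; were it infinite,
its stable image `p^{j₀}B ⊆ B` would be a non-zero `D_𝔭`-stable divisible subgroup fixed pointwise by the tower group, proper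
by (ii), hence with `≤ p` points of order `p`, against (i′). [cite: GreenbergLNM1716, §3 Lemma 3.3 (p. 87)]
[cite: JetchevSkinnerWan2017, Prop. 3.3.4 Case 3(b) (arXiv:1512.06894 p. 13)] -/
theorem _root_.Literature.NumberTheory.EllipticCurves.IwasawaTowerTorsion.WeierstrassCurve.localTowerTorsionFiniteAt_of_noFixedStableDivisibleLine
    {K : Type} [Field K] [NumberField K] (E : WeierstrassCurve K) [E.IsElliptic] (p : ℕ)
    [hp : Fact p.Prime] (κ : ZpExtension K p) (𝔭 : HeightOneSpectrum (𝓞 K))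
    (hline : ∀ N : AddSubgroup (E.geomPrimaryTorsion p),
      (∀ d ∈ decomp 𝔭, ∀ c ∈ N, d • c ∈ N) → (∀ c ∈ N, ∃ c' ∈ N, p • c' = c) →
      Set.ncard {c : E.geomPrimaryTorsion p | c ∈ N ∧ p • c = 0} ≤ p →
      (∀ c ∈ N, ∀ g ∈ decomp 𝔭 ⊓ κ.kerSubgroup, g • c = c) → N = ⊥)
    (hmove : ∃ m : E.geomPrimaryTorsion p, p • m = 0 ∧
      ∃ g ∈ decomp 𝔭 ⊓ κ.kerSubgroup, g • m ≠ m) :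
    (FixedPoints.addSubgroup ↥(decomp 𝔭 ⊓ κ.kerSubgroup) (E.geomPrimaryTorsion p) :
      Set (E.geomPrimaryTorsion p)).Finite := by
  have hpr : p.Prime := hp.out
  set M : AddSubgroup E.geomPoints := E.geomPrimaryTorsion p with hM
  set H : Subgroup (absoluteGaloisGroup K) := decomp 𝔭 ⊓ κ.kerSubgroup with hH
  set B : AddSubgroup M := FixedPoints.addSubgroup H M with hB
  by_contra hinf
  have hinfB : ¬ Finite B := fun h ↦ by
    haveI := h
    exact hinf (Set.toFinite _)
  -- `H` is normalised by `D_𝔭`: `d⁻¹ τ d ∈ H` for `d ∈ D_𝔭`, `τ ∈ H`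
  have hconj : ∀ d ∈ decomp 𝔭, ∀ τ ∈ H, d⁻¹ * τ * d ∈ H := by
    intro d hd τ hτ
    obtain ⟨hτD, hτk⟩ := Subgroup.mem_inf.mp hτ
    refine Subgroup.mem_inf.mpr ⟨(decomp 𝔭).mul_mem ((decomp 𝔭).mul_mem ((decomp 𝔭).inv_mem hd) hτD) hd, ?_⟩
    rw [ZpExtension.mem_kerSubgroup] at hτk ⊢
    rw [map_mul, map_mul, map_inv, hτk, mul_one, inv_mul_cancel]
  -- hence the fixed module `B` is `D_𝔭`-stable
  have hBstab : ∀ d ∈ decomp 𝔭, ∀ {m : M}, m ∈ B → d • m ∈ B := by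
    intro d hd m hm
    rw [hB, FixedPoints.mem_addSubgroup] at hm ⊢
    rintro ⟨τ, hτ⟩
    have h := hm ⟨d⁻¹ * τ * d, hconj d hd τ hτ⟩
    rw [Subgroup.mk_smul] at h ⊢
    calc τ • d • m = d • ((d⁻¹ * τ * d) • m) := by rw [mul_smul, mul_smul, smul_inv_smul]
      _ = d • m := by rw [h]
  -- `M` and `B` are `p`-primary, `B[p]` is finite
  have htorM : ∀ x : M, ∃ k : ℕ, p ^ k • x = 0 := fun x ↦ by
    obtain ⟨k, hk⟩ := x.2
    exact ⟨k, Subtype.ext (by rw [AddSubgroupClass.coe_nsmul, hk]; rfl)⟩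
  have hprimB : ∀ b : B, ∃ k : ℕ, p ^ k • b = 0 := fun b ↦ by
    obtain ⟨k, hk⟩ := htorM (b : M)
    exact ⟨k, Subtype.ext (by rw [AddSubgroupClass.coe_nsmul, hk]; rfl)⟩
  haveI : Finite (E.geomTorsion ((p : ℕ) : ℤ)) :=
    E.finite_torsionPoints_holds (AlgebraicClosure K) (by exact_mod_cast hpr.ne_zero)
  haveI : Finite ((B)[(p : ℕ)]) := by
    refine Finite.of_injective (fun x : (B)[(p : ℕ)] ↦
      (⟨(((x : B) : M) : E.geomPoints), ?_⟩ : E.geomTorsion ((p : ℕ) : ℤ))) ?_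
    · refine AddSubgroup.torsionBy.nsmul_iff.mpr ?_
      have h := congrArg (fun b : B ↦ ((b : M) : E.geomPoints))
        (AddSubgroup.torsionBy.nsmul_iff.mp x.2)
      simpa only [AddSubmonoidClass.coe_nsmul, ZeroMemClass.coe_zero] using h
    · intro x y hxy
      have h := congrArg Subtype.val hxy
      dsimp only at h
      exact Subtype.ext (Subtype.ext (Subtype.ext h))
  -- the stable image `D₀ = p^{j₀} B`: infinite and `p`-divisible
  obtain ⟨j₀, hj₀⟩ := PrimaryGroup.exists_powRange_succ_eq p hprimB
  obtain ⟨t, ht⟩ := PrimaryGroup.exists_card_quotient_powRange_le p hprimB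
  set D₀ : AddSubgroup B := (nsmulAddMonoidHom (p ^ j₀) : B →+ B).range with hD₀
  have hD₀inf : ¬ Finite D₀ := by
    intro hfin
    apply hinfB
    haveI := (ht j₀).1
    refine Nat.finite_of_card_ne_zero ?_
    rw [← AddSubgroup.card_mul_index D₀, AddSubgroup.index_eq_card]
    exact mul_ne_zero Nat.card_pos.ne' Nat.card_pos.ne'
  have hdiv₀ : ∀ x ∈ D₀, ∃ y ∈ D₀, p • y = x := by
    rintro x hx
    have hx' : x ∈ (nsmulAddMonoidHom (p ^ (j₀ + 1)) : B →+ B).range := by rw [hj₀]; exact hx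
    obtain ⟨c, rfl⟩ := hx'
    refine ⟨p ^ j₀ • c, ⟨c, rfl⟩, ?_⟩
    change p • p ^ j₀ • c = p ^ (j₀ + 1) • c
    rw [pow_succ', mul_smul]
  -- push the stable image down to `M = E[p^∞]`
  set N : AddSubgroup M := D₀.map B.subtype with hN
  have hNdiv : ∀ c ∈ N, ∃ c' ∈ N, p • c' = c := by
    rintro _ ⟨b, hb, rfl⟩
    obtain ⟨c, hc, hcb⟩ := hdiv₀ b hb
    exact ⟨B.subtype c, ⟨c, hc, rfl⟩, by rw [← map_nsmul, hcb]⟩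
  have hNstab : ∀ d ∈ decomp 𝔭, ∀ c ∈ N, d • c ∈ N := by
    rintro d hd _ ⟨b, ⟨c, rfl⟩, rfl⟩
    set c' : B := ⟨d • (c : M), hBstab d hd c.2⟩ with hc'
    refine ⟨p ^ j₀ • c', ⟨c', rfl⟩, ?_⟩
    rw [map_nsmul, nsmulAddMonoidHom_apply, map_nsmul, smul_comm d (p ^ j₀) (B.subtype c)]
    rfl
  have hNfix : ∀ c ∈ N, ∀ g ∈ H, g • c = c := by
    rintro _ ⟨b, -, rfl⟩ g hg
    have hb : (b : M) ∈ FixedPoints.addSubgroup H M := b.2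
    rw [FixedPoints.mem_addSubgroup] at hb
    have h := hb ⟨g, hg⟩
    rw [Subgroup.mk_smul] at h
    exact h
  -- `N ≠ ⊤` by (ii)
  have hNtop : N ≠ ⊤ := by
    intro htop
    obtain ⟨m, -, g, hg, hne⟩ := hmove
    exact hne (hNfix m (by rw [htop]; exact AddSubgroup.mem_top m) g hg)
  -- so `#N[p] ≤ p`, and (i) kills `N`
  have hN1 : Set.ncard {c : E.geomPrimaryTorsion p | c ∈ N ∧ p • c = 0} ≤ p :=
    ncard_pTorsion_le_of_divisible_of_ne_top N htorM (ncard_geomPrimaryTorsion_pTorsion_eq_sq E)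
      hNdiv hNtop
  have hNbot : N = ⊥ := hline N hNstab hNdiv hN1 hNfix
  apply hD₀inf
  haveI : Subsingleton D₀ := by
    refine ⟨fun x y ↦ Subtype.ext (B.subtype_injective ?_)⟩
    have hx : B.subtype (x : B) ∈ N := ⟨x, x.2, rfl⟩
    have hy : B.subtype (y : B) ∈ N := ⟨y, y.2, rfl⟩
    rw [hNbot, AddSubgroup.mem_bot] at hx hy
    rw [hx, hy]
  infer_instance

end Literature.NumberTheory.EllipticCurves.IwasawaTowerTorsion.FiniteOrdinary

end Part9

/-!
## Part 10 — port of `Summits/BirchSwinnertonDyer/BirchSwinnertonDyer/Theorems/KatoDescentPotSupersingularTowerTorsionFiniteOrdinary.lean` (5 declarations kept)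

# Imai's finiteness `W(ℚ_{p,∞})[p^∞] < ∞` on the potentially ordinary rows — hence at every potentially good odd prime

Declarations of this Part (verbatim port; each keeps its own docstring and citation): `mem_kerSubgroup_of_forall_smul_rootOfUnity_eq`, `under_eq_of_mem`, `eq_bot_of_divisible_of_fixed_of_potentiallyOrdinary`, `finite_fixedPoints_kerSubgroup_inf_decomp_of_potentiallyOrdinary`, `finite_fixedPoints_kerSubgroup_inf_decomp_of_padicValRat_j_nonneg`.

Reference keys (see `references.bib` and the declarations' citations): [Imai1975], [Washington1997], [GreenbergLNM1716], [NeukirchANT1999], [SerreInventiones1972], [Serre1967GroupesPDivisibles].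
-/

section Part10

open scoped _root_.Classical _root_.NumberField AddSubgroup
open _root_.Function _root_.Field _root_.NumberField _root_.IsDedekindDomain _root_.WeierstrassCurve
open Literature.NumberTheory.EllipticCurves Literature.NumberTheory.EllipticCurves.GreenbergSelmer
open Literature.NumberTheory.GaloisRepresentations
open Literature.NumberTheory.EllipticCurves.IwasawaTowerTorsion.LocalTowerTorsionLine
open Literature.NumberTheory.EllipticCurves.IwasawaTowerTorsion

universe u

namespace Literature.NumberTheory.EllipticCurves.IwasawaTowerTorsion.FiniteOrdinary

/-! ## §6 No FIXED stable divisible line at a potentially ORDINARY prime (transport `ℚ̄ → F̄`) -/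

/-- **Membership in `ker κ` for the cyclotomic `ℤ_p`-extension from fixing `μ_{p^∞}`**: an element of `Γ_K` fixing every
`p`-power root of unity of `K̄` has cyclotomic character `1`, hence lies in `ker κ = χ_p⁻¹(μ(ℤ_p))`.
[cite: Washington1997, §13.1] -/
theorem mem_kerSubgroup_of_forall_smul_rootOfUnity_eq {K : Type u} [Field K] [NumberField K] {p : ℕ} [hp : Fact p.Prime]
    (κ : ZpExtension K p) (hκ : κ.IsCyclotomic) {σ : absoluteGaloisGroup K}
    (hfix : ∀ (k : ℕ) (t : AlgebraicClosure K), t ^ p ^ k = 1 → σ • t = t) : σ ∈ κ.kerSubgroup := by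
  have hpp := hp.out
  have hχ : GaloisRep.cyclotomicCharacter K p σ = 1 := by
    haveI : NeZero (p : K) := ⟨Nat.cast_ne_zero.mpr hpp.ne_zero⟩
    refine Units.ext (PadicInt.ext_of_toZModPow.mp fun k ↦ ?_)
    rw [Units.val_one, map_one]
    cases k with
    | zero =>
      haveI : Subsingleton (ZMod (p ^ 0)) := by rw [pow_zero]; infer_instance
      exact Subsingleton.elim _ _
    | succ k =>
      haveI : NeZero ((p ^ (k + 1) : ℕ) : AlgebraicClosure K) :=
        ⟨by exact_mod_cast pow_ne_zero (k + 1) hpp.ne_zero⟩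
      obtain ⟨t, ht⟩ := HasEnoughRootsOfUnity.exists_primitiveRoot (AlgebraicClosure K) (p ^ (k + 1))
      have hspec := GaloisRep.cyclotomicCharacter_spec K p (k := k + 1) σ t ht.pow_eq_one
      rw [hfix (k + 1) t ht.pow_eq_one] at hspec
      have hlt : 1 < p ^ (k + 1) := Nat.one_lt_pow (by omega) hpp.one_lt
      haveI : Fact (1 < p ^ (k + 1)) := ⟨hlt⟩
      have hc := ht.pow_inj (ZMod.val_lt _) hlt (hspec.symm.trans (pow_one t).symm)
      exact ZMod.val_injective _ (hc.trans (ZMod.val_one _).symm)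
  rw [show κ.kerSubgroup = _ from hκ, Subgroup.mem_comap, CommGroup.mem_torsion]
  change IsOfFinOrder (GaloisRep.cyclotomicCharacter K p σ)
  rw [hχ]
  exact IsOfFinOrder.one

/-- The prime of `ℤ` under a place `w ∋ p` of a number field is the place of `ℚ` at `p`. [cite: Imai1975, Theorem (p. 12)] -/
theorem under_eq_of_mem {F : Type} [Field F] [NumberField F] {p : ℕ} (hp : p.Prime) (w : HeightOneSpectrum (𝓞 F))
    (hpw : (p : 𝓞 F) ∈ w.asIdeal) (v : HeightOneSpectrum (𝓞 ℚ)) (hpv : (p : 𝓞 ℚ) ∈ v.asIdeal) :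
    w.asIdeal.under (𝓞 ℚ) = v.asIdeal := by
  have hprime : (w.asIdeal.under (𝓞 ℚ)).IsPrime := Ideal.IsPrime.under (𝓞 ℚ) w.asIdeal
  have hmem : (p : 𝓞 ℚ) ∈ w.asIdeal.under (𝓞 ℚ) := by
    rw [Ideal.under_def, Ideal.mem_comap, map_natCast]; exact hpw
  have hne : w.asIdeal.under (𝓞 ℚ) ≠ ⊥ := by
    intro h0
    rw [h0, Ideal.mem_bot] at hmem
    exact hp.ne_zero (by exact_mod_cast hmem)
  let u : HeightOneSpectrum (𝓞 ℚ) := ⟨w.asIdeal.under (𝓞 ℚ), hprime, hne⟩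
  have hu : u = Rat.HeightOneSpectrum.primesEquiv.symm ⟨p, hp⟩ :=
    (natCast_mem_asIdeal_iff_eq_primesEquiv_symm u hp).mp hmem
  have hv : v = Rat.HeightOneSpectrum.primesEquiv.symm ⟨p, hp⟩ :=
    (natCast_mem_asIdeal_iff_eq_primesEquiv_symm v hp).mp hpv
  have huv : u = v := hu.trans hv.symm
  exact congrArg HeightOneSpectrum.asIdeal huv

/-- **No `p`-divisible subgroup of `W(ℚ̄)[p^∞]` is fixed pointwise by the local cyclotomic tower group `D_v ⊓ ker κ` at a
potentially ORDINARY `p`** (`W/ℚ` with good ORDINARY reduction at some place `w ∣ p` of some number field `F`; `κ` the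
cyclotomic `ℤ_p`-extension of `ℚ`, `v` the place at `p`).  Transport (as in the tree's proof of Serre 1967 Prop. 8): move `N` by
`τ ∈ Γ_ℚ` so that the decomposition group of the prime of `ℤ̄` cut out by `F̄ → F̄_w` is carried into `D_v`, push it along the
`Γ_F`-equivariant injection `W(ℚ̄) → W_F(F̄)`; the image is `p`-divisible and fixed by the element `γ = ι·σ_w^e` of §4 (whose
restriction to `ℚ̄` fixes `μ_{p^∞}`, hence lies in `ker κ`, `mem_kerSubgroup_of_forall_smul_rootOfUnity_eq`), so it is zero by
the local ordinary lemma. [cite: Imai1975, Theorem (p. 12)] [cite: GreenbergLNM1716, §2 p. 70 and §3 Lemma 3.3]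
[cite: NeukirchANT1999, Ch. I §9 (9.1), (9.4)] -/
theorem eq_bot_of_divisible_of_fixed_of_potentiallyOrdinary (W : WeierstrassCurve ℚ) [W.IsElliptic] (p : ℕ)
    [hp : Fact p.Prime] {F : Type} [Field F] [NumberField F] (w : HeightOneSpectrum (𝓞 F))
    (hpw : (p : 𝓞 F) ∈ w.asIdeal) (hgood : (W.baseChange F).HasGoodReductionAt w)
    (hunit : (W.baseChange F).HasUnitRootAt w) (κ : ZpExtension ℚ p) (hκ : κ.IsCyclotomic)
    (v : HeightOneSpectrum (𝓞 ℚ)) (hpv : (p : 𝓞 ℚ) ∈ v.asIdeal) (N : AddSubgroup (W.geomPrimaryTorsion p))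
    (hNdiv : ∀ c ∈ N, ∃ c' ∈ N, p • c' = c) (hNfix : ∀ c ∈ N, ∀ g ∈ decomp v ⊓ κ.kerSubgroup, g • c = c) :
    N = ⊥ := by
  have hpp : p.Prime := hp.out
  haveI : (W.baseChange F).IsElliptic := inferInstanceAs (W.map (algebraMap ℚ F)).IsElliptic
  -- the local ordinary lemma at `w`
  obtain ⟨γ, -, hγμ, hloc⟩ :=
    exists_fixing_rootsOfUnity_forall_eq_bot_of_hasUnitRootAt (W.baseChange F) p w hpw hgood hunit
  -- decomposition groups: `𝔔₀ = adicCompletionPrime F w`, `𝔓 ∣ v` below it, `τ • 𝔓₀ = 𝔓`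
  have hw : w.asIdeal.under (𝓞 ℚ) = v.asIdeal := under_eq_of_mem hpp w hpw v hpv
  obtain ⟨𝔓, h𝔓, hD⟩ := exists_primesAbove_decompositionSubgroup_le_comap ℚ F hw
    (adicCompletionPrime_mem_primesAbove (F : Type) w)
  obtain ⟨τ, hτ⟩ := HeightOneSpectrum.exists_smul_eq_of_mem_primesAbove_holds
    (adicCompletionPrime_mem_primesAbove ℚ v) h𝔓
  -- the embedding `ℚ̄ → F̄` and the restrictions
  let ι₁ : AlgebraicClosure ℚ →ₐ[ℚ] AlgebraicClosure F := closureEmb (K := ℚ) F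
  have hres₁ : ∀ σ : absoluteGaloisGroup F, resGalOfEmb ι₁ σ = absGaloisRestrict ℚ F σ := fun σ => by
    rw [show ι₁ = closureEmb (K := ℚ) F from rfl, ← resGal_eq, WeierstrassCurve.resGal_eq_absGaloisRestrict]
  have hres₂ : ∀ γ' : absoluteGaloisGroup (w.adicCompletion F),
      resGal (K := F) (w.adicCompletion F) γ' = absGaloisRestrict F (w.adicCompletion F) γ' := fun γ' => by
    rw [WeierstrassCurve.resGal_eq_absGaloisRestrict]
  -- `δ γ = (γ|_{F̄})|_{ℚ̄}` and `φ γ = τ⁻¹ δ τ ∈ D_v ⊓ ker κ`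
  set ρ : absoluteGaloisGroup F := absGaloisRestrict F (w.adicCompletion F) γ with hρ
  set δ : absoluteGaloisGroup ℚ := resGalOfEmb ι₁ ρ with hδ
  have hδD : δ ∈ 𝔓.decompositionSubgroup (absoluteGaloisGroup ℚ) := by
    have h2 : ρ ∈ (adicCompletionPrime (F : Type) w).decompositionSubgroup (absoluteGaloisGroup F) := by
      rw [hρ, decompositionSubgroup_adicCompletionPrime_eq_range]
      exact ⟨γ, rfl⟩
    have h1 := hD _ h2
    rwa [← hres₁] at h1
  have hφD : τ⁻¹ * δ * τ ∈ decomp v := by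
    change τ⁻¹ * δ * τ ∈ (absGaloisRestrict ℚ (v.adicCompletion ℚ)).toMonoidHom.range
    rw [← decompositionSubgroup_adicCompletionPrime_eq_range]
    have h1 := hδD
    rw [← hτ, Ideal.decompositionSubgroup_smul, Subgroup.mem_pointwise_smul_iff_inv_smul_mem,
      MulAut.smul_def, MulAut.conj_inv_apply] at h1
    exact h1
  have hδfix : ∀ (k : ℕ) (t : AlgebraicClosure ℚ), t ^ p ^ k = 1 → δ • t = t := by
    intro k t ht
    apply ι₁.toRingHom.injective
    have h1 : ι₁ (δ • t) = (show AlgebraicClosure F ≃ₐ[F] AlgebraicClosure F from ρ) (ι₁ t) := by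
      rw [hδ]
      exact apply_resGalAuxOfEmb_apply ι₁ ρ t
    change ι₁ (δ • t) = ι₁ t
    rw [h1]
    exact hγμ k (ι₁ t) (by rw [← map_pow, ht, map_one])
  have hδker : δ ∈ κ.kerSubgroup := mem_kerSubgroup_of_forall_smul_rootOfUnity_eq κ hκ hδfix
  have hφker : τ⁻¹ * δ * τ ∈ κ.kerSubgroup := by
    rw [ZpExtension.mem_kerSubgroup] at hδker ⊢
    rw [map_mul, map_mul, map_inv, hδker, mul_one, inv_mul_cancel]
  -- the transport map `g = ι₁_* ∘ (τ • ·)` on `W(ℚ̄)[p^∞]`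
  let g : ↥(W.geomPrimaryTorsion p) →+ geomPoints (W.baseChange F) :=
    (geomPointsMapOfEmb W ι₁).comp
      ((DistribSMul.toAddMonoidHom (geomPoints W) τ).comp (W.geomPrimaryTorsion p).subtype)
  have hg : ∀ c, g c = geomPointsMapOfEmb W ι₁ (τ • (c : geomPoints W)) := fun c => rfl
  have hg_inj : Function.Injective g := by
    intro a b hab
    rw [hg, hg] at hab
    exact Subtype.ext (MulAction.injective τ (geomPointsMapOfEmb_injective _ _ hab))
  have hφg : ∀ c, g ((τ⁻¹ * δ * τ) • c) = ρ • g c := by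
    intro c
    rw [hg, hg, primaryComponent.coe_smul, smul_smul]
    have hmul : τ * (τ⁻¹ * δ * τ) = resGalOfEmb ι₁ ρ * τ := by
      change τ * (τ⁻¹ * δ * τ) = δ * τ
      group
    rw [hmul, mul_smul, geomPointsMapOfEmb_smul]
  -- hypotheses on `N₁ = g(N)`
  set N₁ : AddSubgroup (geomPoints (W.baseChange F)) := N.map g with hN₁
  have hmem : ∀ {c' : geomPoints (W.baseChange F)}, c' ∈ N₁ ↔ ∃ c ∈ N, g c = c' := fun {c'} => by
    rw [hN₁, AddSubgroup.mem_map]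
  have hprim : ∀ c' ∈ N₁, ∃ k : ℕ, p ^ k • c' = 0 := by
    intro c' hc'
    obtain ⟨c, -, rfl⟩ := hmem.mp hc'
    obtain ⟨k, hk⟩ := (AddCommGroup.mem_primaryComponent.mp c.2)
    refine ⟨k, ?_⟩
    have hk' : p ^ k • c = 0 := Subtype.ext (by rw [AddSubmonoidClass.coe_nsmul, hk]; rfl)
    rw [← map_nsmul, hk', map_zero]
  have hdiv : ∀ c' ∈ N₁, ∃ c'' ∈ N₁, p • c'' = c' := by
    intro c' hc'
    obtain ⟨c, hc, rfl⟩ := hmem.mp hc'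
    obtain ⟨c₁, hc₁, hpc₁⟩ := hNdiv c hc
    exact ⟨g c₁, hmem.mpr ⟨c₁, hc₁, rfl⟩, by rw [← map_nsmul, hpc₁]⟩
  have hfixN : ∀ c' ∈ N₁, ρ • c' = c' := by
    intro c' hc'
    obtain ⟨c, hc, rfl⟩ := hmem.mp hc'
    rw [← hφg, hNfix c hc _ (Subgroup.mem_inf.mpr ⟨hφD, hφker⟩)]
  have hN₁bot : N₁ = ⊥ := hloc N₁ hprim hdiv hfixN
  rw [eq_bot_iff]
  intro c hc
  have : g c ∈ N₁ := hmem.mpr ⟨c, hc, rfl⟩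
  rw [hN₁bot, AddSubgroup.mem_bot] at this
  rw [AddSubgroup.mem_bot]
  exact hg_inj (by rw [this, map_zero])

/-! ## §7 Imai's finiteness on the potentially ORDINARY rows, and at every potentially good ODD prime -/

/-- **Imai's finiteness `W(ℚ_{p,∞})[p^∞] < ∞` at a potentially ORDINARY odd prime — the displayed `hImaiOrd` schema of crux M's
closers () as a KERNEL THEOREM for odd `p`.**  For an elliptic curve `W/ℚ`, an odd prime `p` at which `W` acquires good
ORDINARY reduction at some place `w ∣ p` of some number field, the cyclotomic `ℤ_p`-extension `κ` of `ℚ` and the place `v` of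
`ℚ` at `p`, the points of `W(ℚ̄)[p^∞]` fixed by `ker κ ⊓ D_v` form a FINITE group — VERBATIM the conclusion of the Imai fact
`imai1975_finite_fixedPoints_kerSubgroup_inf_decomp_of_padicValRat_j_nonneg` and the hypothesis `hfin` of H2X / H2X⁺ on these
rows.  Proof: the line-free reduction of §5 with (i′) = §6 and (ii) = kmc's moved `p`-torsion point (`μ_p ⊄ ℚ_p`, `p` odd).
[cite: Imai1975, Theorem (p. 12)] [cite: GreenbergLNM1716, §1 p. 62, §2 p. 70, §3 Lemma 3.3 (p. 87)]
[cite: SerreInventiones1972, §1.11 Prop. 11] -/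
theorem finite_fixedPoints_kerSubgroup_inf_decomp_of_potentiallyOrdinary (W : WeierstrassCurve ℚ) [W.IsElliptic]
    (p : ℕ) [Fact p.Prime] (hp2 : p ≠ 2)
    (hpo : ∃ (F : Type) (_ : Field F) (_ : NumberField F) (w : HeightOneSpectrum (𝓞 F)),
      ((p : ℕ) : 𝓞 F) ∈ w.asIdeal ∧ (W.baseChange F).HasGoodReductionAt w ∧ (W.baseChange F).HasUnitRootAt w)
    (κ : ZpExtension ℚ p) (hκ : κ.IsCyclotomic) (v : HeightOneSpectrum (𝓞 ℚ))
    (hv : ((Rat.HeightOneSpectrum.primesEquiv v : Nat.Primes) : ℕ) = p) :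
    Finite (FixedPoints.addSubgroup ↥(κ.kerSubgroup ⊓ decomp v) (W.geomPrimaryTorsion p)) := by
  have hpr : p.Prime := Fact.out
  have hpv : ((p : ℕ) : 𝓞 ℚ) ∈ v.asIdeal :=
    (natCast_mem_asIdeal_iff_eq_primesEquiv_symm v hpr).mpr
      ((Equiv.eq_symm_apply _).mpr (Subtype.ext hv))
  obtain ⟨F, _, _, w, hpw, hgood, hunit⟩ := hpo
  have hfin := Literature.NumberTheory.EllipticCurves.IwasawaTowerTorsion.WeierstrassCurve.localTowerTorsionFiniteAt_of_noFixedStableDivisibleLine W p κ v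
    (fun N _ hNdiv _ hNfix ↦
      eq_bot_of_divisible_of_fixed_of_potentiallyOrdinary W p w hpw hgood hunit κ hκ v hpv N hNdiv hNfix)
    (Finite.exists_pTorsion_not_fixed_rat W p hp2 κ v hv)
  rw [inf_comm]
  exact hfin.to_subtype

/-- **Imai's finiteness at EVERY potentially good ODD prime** (`0 ≤ ord_p j(W)`, `κ` cyclotomic, `v` the place at `p`): the
potentially SUPERSINGULAR rows are the tree theorem of the prequel
(`Finite.finite_fixedPoints_kerSubgroup_inf_decomp_of_potentiallySupersingular`, Serre 1967 Prop. 8), the potentially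
ORDINARY rows are §7's theorem.  This is the Imai named fact `imai1975_finite_fixedPoints_kerSubgroup_inf_decomp_of_padicValRat_j_nonneg`
RESTRICTED TO ODD `p` — the only parity crux M and the H2X⁺ consumers ever use. [cite: Imai1975, Theorem (p. 12)]
[cite: Serre1967GroupesPDivisibles, §5 Prop. 8] [cite: GreenbergLNM1716, §3 Lemma 3.3 (p. 87)] -/
theorem finite_fixedPoints_kerSubgroup_inf_decomp_of_padicValRat_j_nonneg (W : WeierstrassCurve ℚ) [W.IsElliptic]
    (p : ℕ) [Fact p.Prime] (hp2 : p ≠ 2) (hj : 0 ≤ padicValRat p W.j)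
    (κ : ZpExtension ℚ p) (hκ : κ.IsCyclotomic) (v : HeightOneSpectrum (𝓞 ℚ))
    (hv : ((Rat.HeightOneSpectrum.primesEquiv v : Nat.Primes) : ℕ) = p) :
    Finite (FixedPoints.addSubgroup ↥(κ.kerSubgroup ⊓ decomp v) (W.geomPrimaryTorsion p)) := by
  by_cases hss : ∀ (F : Type) [Field F] [NumberField F] (w : HeightOneSpectrum (𝓞 F)),
      ((p : ℕ) : 𝓞 F) ∈ w.asIdeal → (W.baseChange F).HasGoodReductionAt w → ¬ (W.baseChange F).HasUnitRootAt w
  · exact Finite.finite_fixedPoints_kerSubgroup_inf_decomp_of_potentiallySupersingular W p hp2 hj hss κ v hv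
  · push Not at hss
    obtain ⟨F, _, _, w, hw, hgoodw, hunit⟩ := hss
    exact finite_fixedPoints_kerSubgroup_inf_decomp_of_potentiallyOrdinary W p hp2
      ⟨F, inferInstance, inferInstance, w, hw, hgoodw, hunit⟩ κ hκ v hv
end Literature.NumberTheory.EllipticCurves.IwasawaTowerTorsion.FiniteOrdinary

end Part10

/-!
## Part 11 — port of `Summits/BirchSwinnertonDyer/BirchSwinnertonDyer/Theorems/KatoDescentPotSupersingularTowerTorsionInversionElement.lean` (4 declarations kept)

# Imai's finiteness at `p = 2`, the missing input: an element of the local cyclotomic tower group acting by inversion on `μ_{p^∞}` moves a `4`-torsion point (Weil pairing `e_4`) — -free helper for M = `ReducibleKatoMember` (K9 / K8-t′); g32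

Declarations of this Part (verbatim port; each keeps its own docstring and citation): `localTowerTorsionFiniteAt_of_noFixedStableDivisibleLine'`, `exists_mem_inertia_forall_smul_rootOfUnity_eq_inv`, `exists_mem_decomp_inf_kerSubgroup_forall_smul_rootOfUnity_eq_inv`, `exists_primaryTorsion_not_fixed_rat_two`.

Reference keys (see `references.bib` and the declarations' citations): [Washington1997], [NeukirchANT1999], [SilvermanAEC2009].
-/

section Part11

open scoped _root_.Classical _root_.NumberField AddSubgroup _root_.NNReal
open _root_.Function _root_.Field _root_.NumberField _root_.IsDedekindDomain _root_.WeierstrassCurve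
open Literature.NumberTheory.EllipticCurves Literature.NumberTheory.EllipticCurves.GreenbergSelmer
open Literature.NumberTheory.GaloisRepresentations
open Literature.NumberTheory.EllipticCurves.IwasawaTowerTorsion.LocalTowerTorsionLine
open Literature.NumberTheory.EllipticCurves.IwasawaTowerTorsion

universe u

namespace Literature.NumberTheory.EllipticCurves.IwasawaTowerTorsion.FiniteOrdinary

/-! ## §1 The line-free reduction with ANY moved `p`-primary point -/

/-- **Fin_v from «no FIXED stable divisible line» and ANY point of `E(K̄)[p^∞]` moved by the tower group** — as
`IwasawaTowerTorsion.WeierstrassCurve.localTowerTorsionFiniteAt_of_noFixedStableDivisibleLine` (FILE 2) with input (ii) weakened from a moved `p`-TORSION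
point to a moved `p`-PRIMARY point (kmc g16's proof, adapted verbatim: the moved point only serves to show that the stable image of the
fixed module is a PROPER subgroup). [cite: GreenbergLNM1716, §3 Lemma 3.3 (p. 87)]
[cite: JetchevSkinnerWan2017, Prop. 3.3.4 Case 3(b) (arXiv:1512.06894 p. 13)] -/
theorem _root_.Literature.NumberTheory.EllipticCurves.IwasawaTowerTorsion.WeierstrassCurve.localTowerTorsionFiniteAt_of_noFixedStableDivisibleLine'
    {K : Type} [Field K] [NumberField K] (E : WeierstrassCurve K) [E.IsElliptic] (p : ℕ)
    [hp : Fact p.Prime] (κ : ZpExtension K p) (𝔭 : HeightOneSpectrum (𝓞 K))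
    (hline : ∀ N : AddSubgroup (E.geomPrimaryTorsion p),
      (∀ d ∈ decomp 𝔭, ∀ c ∈ N, d • c ∈ N) → (∀ c ∈ N, ∃ c' ∈ N, p • c' = c) →
      Set.ncard {c : E.geomPrimaryTorsion p | c ∈ N ∧ p • c = 0} ≤ p →
      (∀ c ∈ N, ∀ g ∈ decomp 𝔭 ⊓ κ.kerSubgroup, g • c = c) → N = ⊥)
    (hmove : ∃ m : E.geomPrimaryTorsion p, ∃ g ∈ decomp 𝔭 ⊓ κ.kerSubgroup, g • m ≠ m) :
    (FixedPoints.addSubgroup ↥(decomp 𝔭 ⊓ κ.kerSubgroup) (E.geomPrimaryTorsion p) :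
      Set (E.geomPrimaryTorsion p)).Finite := by
  have hpr : p.Prime := hp.out
  set M : AddSubgroup E.geomPoints := E.geomPrimaryTorsion p with hM
  set H : Subgroup (absoluteGaloisGroup K) := decomp 𝔭 ⊓ κ.kerSubgroup with hH
  set B : AddSubgroup M := FixedPoints.addSubgroup H M with hB
  by_contra hinf
  have hinfB : ¬ Finite B := fun h ↦ by
    haveI := h
    exact hinf (Set.toFinite _)
  -- `H` is normalised by `D_𝔭`: `d⁻¹ τ d ∈ H` for `d ∈ D_𝔭`, `τ ∈ H`
  have hconj : ∀ d ∈ decomp 𝔭, ∀ τ ∈ H, d⁻¹ * τ * d ∈ H := by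
    intro d hd τ hτ
    obtain ⟨hτD, hτk⟩ := Subgroup.mem_inf.mp hτ
    refine Subgroup.mem_inf.mpr ⟨(decomp 𝔭).mul_mem ((decomp 𝔭).mul_mem ((decomp 𝔭).inv_mem hd) hτD) hd, ?_⟩
    rw [ZpExtension.mem_kerSubgroup] at hτk ⊢
    rw [map_mul, map_mul, map_inv, hτk, mul_one, inv_mul_cancel]
  -- hence the fixed module `B` is `D_𝔭`-stable
  have hBstab : ∀ d ∈ decomp 𝔭, ∀ {m : M}, m ∈ B → d • m ∈ B := by
    intro d hd m hm
    rw [hB, FixedPoints.mem_addSubgroup] at hm ⊢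
    rintro ⟨τ, hτ⟩
    have h := hm ⟨d⁻¹ * τ * d, hconj d hd τ hτ⟩
    rw [Subgroup.mk_smul] at h ⊢
    calc τ • d • m = d • ((d⁻¹ * τ * d) • m) := by rw [mul_smul, mul_smul, smul_inv_smul]
      _ = d • m := by rw [h]
  -- `M` and `B` are `p`-primary, `B[p]` is finite
  have htorM : ∀ x : M, ∃ k : ℕ, p ^ k • x = 0 := fun x ↦ by
    obtain ⟨k, hk⟩ := x.2
    exact ⟨k, Subtype.ext (by rw [AddSubgroupClass.coe_nsmul, hk]; rfl)⟩
  have hprimB : ∀ b : B, ∃ k : ℕ, p ^ k • b = 0 := fun b ↦ by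
    obtain ⟨k, hk⟩ := htorM (b : M)
    exact ⟨k, Subtype.ext (by rw [AddSubgroupClass.coe_nsmul, hk]; rfl)⟩
  haveI : Finite (E.geomTorsion ((p : ℕ) : ℤ)) :=
    E.finite_torsionPoints_holds (AlgebraicClosure K) (by exact_mod_cast hpr.ne_zero)
  haveI : Finite ((B)[(p : ℕ)]) := by
    refine Finite.of_injective (fun x : (B)[(p : ℕ)] ↦
      (⟨(((x : B) : M) : E.geomPoints), ?_⟩ : E.geomTorsion ((p : ℕ) : ℤ))) ?_
    · refine AddSubgroup.torsionBy.nsmul_iff.mpr ?_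
      have h := congrArg (fun b : B ↦ ((b : M) : E.geomPoints))
        (AddSubgroup.torsionBy.nsmul_iff.mp x.2)
      simpa only [AddSubmonoidClass.coe_nsmul, ZeroMemClass.coe_zero] using h
    · intro x y hxy
      have h := congrArg Subtype.val hxy
      dsimp only at h
      exact Subtype.ext (Subtype.ext (Subtype.ext h))
  -- the stable image `D₀ = p^{j₀} B`: infinite and `p`-divisible
  obtain ⟨j₀, hj₀⟩ := PrimaryGroup.exists_powRange_succ_eq p hprimB
  obtain ⟨t, ht⟩ := PrimaryGroup.exists_card_quotient_powRange_le p hprimB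
  set D₀ : AddSubgroup B := (nsmulAddMonoidHom (p ^ j₀) : B →+ B).range with hD₀
  have hD₀inf : ¬ Finite D₀ := by
    intro hfin
    apply hinfB
    haveI := (ht j₀).1
    refine Nat.finite_of_card_ne_zero ?_
    rw [← AddSubgroup.card_mul_index D₀, AddSubgroup.index_eq_card]
    exact mul_ne_zero Nat.card_pos.ne' Nat.card_pos.ne'
  have hdiv₀ : ∀ x ∈ D₀, ∃ y ∈ D₀, p • y = x := by
    rintro x hx
    have hx' : x ∈ (nsmulAddMonoidHom (p ^ (j₀ + 1)) : B →+ B).range := by rw [hj₀]; exact hx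
    obtain ⟨c, rfl⟩ := hx'
    refine ⟨p ^ j₀ • c, ⟨c, rfl⟩, ?_⟩
    change p • p ^ j₀ • c = p ^ (j₀ + 1) • c
    rw [pow_succ', mul_smul]
  -- push the stable image down to `M = E[p^∞]`
  set N : AddSubgroup M := D₀.map B.subtype with hN
  have hNdiv : ∀ c ∈ N, ∃ c' ∈ N, p • c' = c := by
    rintro _ ⟨b, hb, rfl⟩
    obtain ⟨c, hc, hcb⟩ := hdiv₀ b hb
    exact ⟨B.subtype c, ⟨c, hc, rfl⟩, by rw [← map_nsmul, hcb]⟩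
  have hNstab : ∀ d ∈ decomp 𝔭, ∀ c ∈ N, d • c ∈ N := by
    rintro d hd _ ⟨b, ⟨c, rfl⟩, rfl⟩
    set c' : B := ⟨d • (c : M), hBstab d hd c.2⟩ with hc'
    refine ⟨p ^ j₀ • c', ⟨c', rfl⟩, ?_⟩
    rw [map_nsmul, nsmulAddMonoidHom_apply, map_nsmul, smul_comm d (p ^ j₀) (B.subtype c)]
    rfl
  have hNfix : ∀ c ∈ N, ∀ g ∈ H, g • c = c := by
    rintro _ ⟨b, -, rfl⟩ g hg
    have hb : (b : M) ∈ FixedPoints.addSubgroup H M := b.2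
    rw [FixedPoints.mem_addSubgroup] at hb
    have h := hb ⟨g, hg⟩
    rw [Subgroup.mk_smul] at h
    exact h
  -- `N ≠ ⊤` by (ii)
  have hNtop : N ≠ ⊤ := by
    intro htop
    obtain ⟨m, g, hg, hne⟩ := hmove
    exact hne (hNfix m (by rw [htop]; exact AddSubgroup.mem_top m) g hg)
  -- so `#N[p] ≤ p`, and (i) kills `N`
  have hN1 : Set.ncard {c : E.geomPrimaryTorsion p | c ∈ N ∧ p • c = 0} ≤ p :=
    ncard_pTorsion_le_of_divisible_of_ne_top N htorM (ncard_geomPrimaryTorsion_pTorsion_eq_sq E)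
      hNdiv hNtop
  have hNbot : N = ⊥ := hline N hNstab hNdiv hN1 hNfix
  apply hD₀inf
  haveI : Subsingleton D₀ := by
    refine ⟨fun x y ↦ Subtype.ext (B.subtype_injective ?_)⟩
    have hx : B.subtype (x : B) ∈ N := ⟨x, x.2, rfl⟩
    have hy : B.subtype (y : B) ∈ N := ⟨y, y.2, rfl⟩
    rw [hNbot, AddSubgroup.mem_bot] at hx hy
    rw [hx, hy]
  infer_instance

/-! ## §2 An inertia element inverting every `p`-power root of unity (`p` a uniformiser at `v`) -/

/-- **An inertia element acting by inversion on `μ_{p^∞}`.**  At a finite place `v ∣ p` of a number field `K` at which `p` is a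
uniformiser of `𝓞_v` (e.g. every `p` for `K = ℚ`), there is `c` in the inertia group `I_𝔐 ≤ Γ_{K_v}` with `c ξ = ξ⁻¹` for EVERY
`p`-power root of unity `ξ ∈ K̄_v`: for each `n` the inertia group acts transitively on the primitive `p^{n+1}`-th roots of unity
(`exists_mem_inertia_smul_eq_of_isPrimitiveRoot`: `K_v(μ_{pⁿ})/K_v` is totally ramified), so some inertia element sends `ζ_n` to
`ζ_n⁻¹`; along a compatible system these closed conditions are decreasing, and Cantor's intersection theorem in the compact inertia
group gives one `c` for all `n`. [cite: NeukirchANT1999, Ch. II (7.13)(i)] [cite: Washington1997, §13.1] -/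
theorem exists_mem_inertia_forall_smul_rootOfUnity_eq_inv {K : Type u} [Field K] [NumberField K] {v : HeightOneSpectrum (𝓞 K)}
    {w : Valuation (AlgebraicClosure (v.adicCompletion K)) ℝ≥0}
    (hw : ∀ x, (w x : ℝ) = spectralNorm (v.adicCompletion K) (AlgebraicClosure (v.adicCompletion K)) x)
    {𝔐 : Ideal v.localAbsIntegers} (h𝔐 : 𝔐 ∈ v.localPrimesAbove) {p : ℕ} [hp : Fact p.Prime]
    (hpv : (p : 𝓞 K) ∈ v.asIdeal) (hϖ : Irreducible ((p : ℕ) : v.adicCompletionIntegers K)) :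
    ∃ c ∈ 𝔐.inertia (absoluteGaloisGroup (v.adicCompletion K)),
      ∀ (k : ℕ) (ξ : AlgebraicClosure (v.adicCompletion K)), ξ ^ p ^ k = 1 → c • ξ = ξ⁻¹ := by
  haveI : CharZero (v.adicCompletion K) :=
    charZero_of_injective_algebraMap (algebraMap K (v.adicCompletion K)).injective
  haveI : CharZero (AlgebraicClosure (v.adicCompletion K)) := charZero_of_injective_algebraMap
    (algebraMap (v.adicCompletion K) (AlgebraicClosure (v.adicCompletion K))).injective
  have hpp := hp.out
  set I : Subgroup (absoluteGaloisGroup (v.adicCompletion K)) :=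
    𝔐.inertia (absoluteGaloisGroup (v.adicCompletion K)) with hIdef
  obtain ⟨z, hz, hzp⟩ : ∃ z : ℕ → AlgebraicClosure (v.adicCompletion K),
      (∀ n, IsPrimitiveRoot (z n) (p ^ (n + 1))) ∧ ∀ n, z (n + 1) ^ p = z n :=
    IsDedekindDomain.HeightOneSpectrum.exists_compatible_primitiveRoots
  -- the roots and their inverses as local absolute integers
  have hz1 : ∀ n, w (z n) ≤ 1 := fun n ↦
    (val_eq_one_of_pow_eq_one w (pow_ne_zero _ hpp.ne_zero) (hz n).pow_eq_one).le
  have hz1' : ∀ n, w (z n)⁻¹ ≤ 1 := fun n ↦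
    (val_eq_one_of_pow_eq_one w (pow_ne_zero _ hpp.ne_zero) (hz n).inv.pow_eq_one).le
  let b : ℕ → v.localAbsIntegers := fun n ↦
    ⟨z n, (IsDedekindDomain.HeightOneSpectrum.mem_localAbsIntegers_iff_spectralValuation hw).mpr (hz1 n)⟩
  let b' : ℕ → v.localAbsIntegers := fun n ↦
    ⟨(z n)⁻¹, (IsDedekindDomain.HeightOneSpectrum.mem_localAbsIntegers_iff_spectralValuation hw).mpr (hz1' n)⟩
  have hb : ∀ (n : ℕ) (τ : absoluteGaloisGroup (v.adicCompletion K)),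
      ((τ • b n : v.localAbsIntegers) : AlgebraicClosure (v.adicCompletion K)) = τ • z n :=
    fun n τ ↦ integralClosure.coe_smul _ _
  -- the closed sets `S n = {ι ∈ I | ι ζ_n = ζ_n⁻¹}`
  let S : ℕ → Set (absoluteGaloisGroup (v.adicCompletion K)) := fun n ↦
    (I : Set (absoluteGaloisGroup (v.adicCompletion K))) ∩ {τ | τ • b n = b' n}
  have hSmem : ∀ n τ, τ ∈ S n ↔ τ ∈ I ∧ τ • z n = (z n)⁻¹ := fun n τ ↦ by
    change τ ∈ (I : Set (absoluteGaloisGroup (v.adicCompletion K))) ∧ τ • b n = b' n ↔ _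
    rw [SetLike.mem_coe, Subtype.ext_iff, hb]
  have hIclosed : IsClosed (I : Set (absoluteGaloisGroup (v.adicCompletion K))) := by
    have e : (I : Set (absoluteGaloisGroup (v.adicCompletion K))) =
        ⋂ x : v.localAbsIntegers, {g : absoluteGaloisGroup (v.adicCompletion K) | g • x - x ∈ 𝔐} := by
      ext g
      simp only [Set.mem_iInter, SetLike.mem_coe, Set.mem_setOf_eq]
      rfl
    rw [e]
    exact isClosed_iInter fun x ↦ IsDedekindDomain.HeightOneSpectrum.isClosed_setOf_smul_sub_mem_local v 𝔐 x
  have hclosed : ∀ n, IsClosed (S n) := fun n ↦ by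
    refine hIclosed.inter ?_
    letI : TopologicalSpace v.localAbsIntegers := ⊥
    haveI : DiscreteTopology v.localAbsIntegers := ⟨rfl⟩
    haveI := absIntegers.continuousSMul (v.adicCompletionIntegers K) (K := v.adicCompletion K)
    have hc : Continuous fun g : absoluteGaloisGroup (v.adicCompletion K) ↦ g • b n :=
      continuous_id.smul continuous_const
    exact (isClosed_discrete {y : v.localAbsIntegers | y = b' n}).preimage hc
  have hanti : ∀ n, S (n + 1) ⊆ S n := fun n τ hτ ↦ by
    rw [hSmem] at hτ ⊢
    refine ⟨hτ.1, ?_⟩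
    rw [← hzp n, smul_pow', hτ.2, inv_pow]
  have hne : ∀ n, (S n).Nonempty := fun n ↦ by
    obtain ⟨ι, hι, hιz⟩ := IsDedekindDomain.HeightOneSpectrum.exists_mem_inertia_smul_eq_of_isPrimitiveRoot hw h𝔐 hpv hϖ n
      (hz n) (hz n).inv
    exact ⟨ι, (hSmem n ι).mpr ⟨hι, hιz⟩⟩
  obtain ⟨c, hc⟩ := IsCompact.nonempty_iInter_of_sequence_nonempty_isCompact_isClosed S hanti hne
    (hclosed 0).isCompact hclosed
  have hcI : c ∈ I := ((hSmem 0 c).mp (Set.mem_iInter.mp hc 0)).1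
  have hcz : ∀ n, c • z n = (z n)⁻¹ := fun n ↦ ((hSmem n c).mp (Set.mem_iInter.mp hc n)).2
  refine ⟨c, hcI, fun k ξ hξ ↦ ?_⟩
  cases k with
  | zero =>
    rw [pow_zero, pow_one] at hξ
    rw [hξ, smul_one, inv_one]
  | succ k =>
    obtain ⟨i, -, rfl⟩ := (hz k).eq_pow_of_pow_eq_one hξ
    rw [smul_pow', hcz k, inv_pow]

/-! ## §3 `K = ℚ`: an element of `D_v ⊓ ker κ` inverting `μ_{p^∞}(ℚ̄)` -/

/-- **For `K = ℚ`, the place `v` at `p` and the cyclotomic `ℤ_p`-extension `κ`: some `σ ∈ D_v ⊓ ker κ` inverts every `p`-power root of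
unity of `ℚ̄`** — the restriction of §2's inertia element (`p` is a uniformiser of `ℤ_p`); `σ² ` fixes `μ_{p^∞}`, so `χ_p(σ)² = 1` is
torsion and `σ ∈ ker κ = χ_p⁻¹(μ(ℤ_p))`. [cite: Washington1997, §13.1] [cite: NeukirchANT1999, Ch. II (7.13)(i)] -/
theorem exists_mem_decomp_inf_kerSubgroup_forall_smul_rootOfUnity_eq_inv (p : ℕ) [hp : Fact p.Prime] (κ : ZpExtension ℚ p)
    (hκ : κ.IsCyclotomic) (v : HeightOneSpectrum (𝓞 ℚ)) (hpv : (p : 𝓞 ℚ) ∈ v.asIdeal) :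
    ∃ σ ∈ decomp v ⊓ κ.kerSubgroup, ∀ (k : ℕ) (t : AlgebraicClosure ℚ), t ^ p ^ k = 1 → σ • t = t⁻¹ := by
  have hpp := hp.out
  obtain ⟨w, hw⟩ := v.exists_spectralValuation
  obtain ⟨𝔐, h𝔐⟩ := v.localPrimesAbove_nonempty
  have hϖ := IsDedekindDomain.HeightOneSpectrum.irreducible_natCast_adicCompletionIntegers_rat (v := v) hpv
  obtain ⟨c, -, hc⟩ := exists_mem_inertia_forall_smul_rootOfUnity_eq_inv hw h𝔐 hpv hϖ
  set σ : absoluteGaloisGroup ℚ := absGaloisRestrict ℚ (v.adicCompletion ℚ) c with hσ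
  -- `σ` inverts the `p`-power roots of unity of `ℚ̄`
  have hσinv : ∀ (k : ℕ) (t : AlgebraicClosure ℚ), t ^ p ^ k = 1 → σ • t = t⁻¹ := by
    intro k t ht
    apply (closureEmb (K := ℚ) (v.adicCompletion ℚ)).toRingHom.injective
    have h1 : closureEmb (K := ℚ) (v.adicCompletion ℚ) (σ • t) = c • closureEmb (K := ℚ) (v.adicCompletion ℚ) t := by
      rw [hσ, ← WeierstrassCurve.resGal_eq_absGaloisRestrict, resGal_eq]
      exact apply_resGalAuxOfEmb_apply _ _ t
    change closureEmb (K := ℚ) (v.adicCompletion ℚ) (σ • t) = closureEmb (K := ℚ) (v.adicCompletion ℚ) t⁻¹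
    rw [h1, map_inv₀]
    exact hc k _ (by rw [← map_pow, ht, map_one])
  refine ⟨σ, Subgroup.mem_inf.mpr ⟨?_, ?_⟩, hσinv⟩
  · change σ ∈ (absGaloisRestrict ℚ (v.adicCompletion ℚ)).toMonoidHom.range
    exact ⟨c, hσ.symm⟩
  · -- `σ² ∈ ker κ`, hence `σ ∈ ker κ` (the kernel is `χ⁻¹(torsion)`)
    have h2 : σ ^ 2 ∈ κ.kerSubgroup := by
      refine mem_kerSubgroup_of_forall_smul_rootOfUnity_eq κ hκ fun k t ht ↦ ?_
      rw [pow_two, mul_smul, hσinv k t ht, smul_inv'', hσinv k t ht, inv_inv]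
    rw [show κ.kerSubgroup = _ from hκ, Subgroup.mem_comap, CommGroup.mem_torsion] at h2 ⊢
    rw [map_pow] at h2
    exact IsOfFinOrder.of_pow h2 two_ne_zero

/-! ## §4 At `p = 2` the tower group moves a `4`-torsion point -/

/-- **At the place of `ℚ` above `2` the local cyclotomic tower group `D_v ⊓ ker κ` moves some point of `W(ℚ̄)[2^∞]`** (a `4`-torsion
point): with `σ` as in §3 (inverting `μ_{2^∞}`), a point `P ∈ W[4]` of order `4` and `S` with `ζ = e_4(S, P)` of order `4`
(non-degeneracy of the Weil pairing at `2P ≠ 0`), if `σ` fixed both `S` and `P` then `ζ = e_4(σS, σP) = σζ = ζ⁻¹`, i.e. `ζ² = 1`.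
[cite: SilvermanAEC2009, Prop. III.8.1 and Cor. III.6.4] [cite: Washington1997, §13.1] -/
theorem exists_primaryTorsion_not_fixed_rat_two (W : WeierstrassCurve ℚ) [W.IsElliptic] (p : ℕ) [hp : Fact p.Prime]
    (hp2 : p = 2) (κ : ZpExtension ℚ p) (hκ : κ.IsCyclotomic) (v : HeightOneSpectrum (𝓞 ℚ))
    (hv : ((Rat.HeightOneSpectrum.primesEquiv v : Nat.Primes) : ℕ) = p) :
    ∃ m : W.geomPrimaryTorsion p, ∃ g ∈ decomp v ⊓ κ.kerSubgroup, g • m ≠ m := by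
  have hpp : p.Prime := hp.out
  have hpv : ((p : ℕ) : 𝓞 ℚ) ∈ v.asIdeal :=
    (natCast_mem_asIdeal_iff_eq_primesEquiv_symm v hpp).mpr ((Equiv.eq_symm_apply _).mpr (Subtype.ext hv))
  obtain ⟨σ, hσ, hσinv⟩ := exists_mem_decomp_inf_kerSubgroup_forall_smul_rootOfUnity_eq_inv p κ hκ v hpv
  -- the Weil pairing on `W[p²] = W[4]`
  have hp0 : (p : ℚ) ≠ 0 := Nat.cast_ne_zero.mpr hpp.ne_zero
  set m : ℕ := p ^ 2 with hmdef
  have hm2 : 2 ≤ m := by rw [hmdef, hp2]; norm_num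
  have hm0 : m ≠ 0 := by omega
  have hmQ : (m : ℚ) ≠ 0 := Nat.cast_ne_zero.mpr hm0
  obtain ⟨e, hpow, haddl, haddr, halt, hnd, hgal⟩ := W.exists_weilPairing_holds m hm2 hmQ
  -- a point `P ∈ W[p²] \ W[p]`
  have hcard2 : Nat.card (geomTorsion W ((p ^ 2 : ℕ) : ℤ)) = p ^ (2 * 2) :=
    card_geomTorsion_pow_eq W p (card_torsionPoints_eq_sq_holds W (AlgebraicClosure ℚ)) hp0 2
  have hcard1 : Nat.card (geomTorsion W ((p ^ 1 : ℕ) : ℤ)) = p ^ (2 * 1) :=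
    card_geomTorsion_pow_eq W p (card_torsionPoints_eq_sq_holds W (AlgebraicClosure ℚ)) hp0 1
  haveI : Finite (geomTorsion W ((p ^ 2 : ℕ) : ℤ)) :=
    Nat.finite_of_card_ne_zero (by rw [hcard2]; exact pow_ne_zero _ hpp.ne_zero)
  haveI : Finite (geomTorsion W ((p ^ 1 : ℕ) : ℤ)) :=
    Nat.finite_of_card_ne_zero (by rw [hcard1]; exact pow_ne_zero _ hpp.ne_zero)
  obtain ⟨P, hP⟩ : ∃ P : geomTorsion W (m : ℤ), p • P ≠ 0 := by
    by_contra hall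
    push Not at hall
    -- then `W[p²] ↪ W[p]`, contradicting the cardinalities
    have hinj : Function.Injective (fun P : geomTorsion W (m : ℤ) ↦
        (⟨(P : geomPoints W), (mem_geomTorsion_iff W _ _).mpr (by
          have h := congrArg (fun Q : geomTorsion W (m : ℤ) ↦ (Q : geomPoints W)) (hall P)
          simpa only [AddSubgroupClass.coe_nsmul, ZeroMemClass.coe_zero, pow_one, natCast_zsmul] using h)⟩ :
          geomTorsion W ((p ^ 1 : ℕ) : ℤ))) := by
      intro P Q hPQ
      have h := congrArg Subtype.val hPQ
      exact Subtype.ext h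
    have hle := Nat.card_le_card_of_injective _ hinj
    rw [hmdef] at hle
    rw [hcard2, hcard1, hp2] at hle
    norm_num at hle
  -- a partner `S` with `e(S, P)` of order `4`: non-degeneracy at `p • P ≠ 0`
  obtain ⟨S, hS⟩ : ∃ S : geomTorsion W (m : ℤ), e S (p • P) ≠ 1 := by
    by_contra hall
    push Not at hall
    exact hP (hnd _ hall)
  have hnsmul_right : ∀ (j : ℕ) (A B : geomTorsion W (m : ℤ)), e A (j • B) = e A B ^ j := by
    intro j A B
    induction j with
    | zero =>
      rw [zero_smul, pow_zero]
      have h := haddr A 0 0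
      rw [add_zero] at h
      have hne : e A 0 ≠ 0 := fun h0 ↦ by
        have h1 := hpow A 0
        rw [h0, zero_pow hm0] at h1
        exact zero_ne_one h1
      exact (mul_eq_left₀ hne).mp h.symm
    | succ j ih => rw [succ_nsmul, haddr, ih, pow_succ]
  set ζ := e S P with hζ
  have hζ2 : ζ ^ p ≠ 1 := by rw [hζ, ← hnsmul_right]; exact hS
  have hζpow : ζ ^ p ^ 2 = 1 := hpow S P
  -- if `σ` fixed `S` and `P`, then `ζ = σ ζ = ζ⁻¹`
  by_contra hcon
  push Not at hcon
  have hfix : ∀ T : geomTorsion W (m : ℤ), σ • T = T := fun T ↦ by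
    obtain ⟨k, hk⟩ : ∃ k : ℕ, p ^ k • (T : geomPoints W) = 0 :=
      ⟨2, by rw [← natCast_zsmul, ← hmdef]; exact (mem_geomTorsion_iff W _ _).mp T.2⟩
    have h := hcon ⟨(T : geomPoints W), ⟨k, hk⟩⟩ σ hσ
    have h' := congrArg (fun x : W.geomPrimaryTorsion p ↦ (x : geomPoints W)) h
    simp only [primaryComponent.coe_smul] at h'
    exact Subtype.ext (by rw [Literature.NumberTheory.EllipticCurves.AddSubgroup.torsionBy.coe_smul]; exact h')
  have hσζ : σ • ζ = ζ⁻¹ := hσinv 2 ζ hζpow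
  have hσζ' : σ • ζ = ζ := by rw [hζ, hgal, hfix, hfix]
  have hζsq : ζ ^ 2 = 1 := by
    have hne : ζ ≠ 0 := fun h0 ↦ by rw [h0, zero_pow (pow_ne_zero _ hpp.ne_zero)] at hζpow; exact zero_ne_one hζpow
    have h : ζ = ζ⁻¹ := hσζ'.symm.trans hσζ
    rw [pow_two]
    nth_rewrite 2 [h]
    exact mul_inv_cancel₀ hne
  exact hζ2 (by rw [hp2]; exact hζsq)

end Literature.NumberTheory.EllipticCurves.IwasawaTowerTorsion.FiniteOrdinary

end Part11

/-!
## Part 12 — port of `Summits/BirchSwinnertonDyer/BirchSwinnertonDyer/Theorems/KatoDescentPotSupersingularTowerTorsionFiniteImai.lean` (4 declarations kept)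

# Imai 1975: `W(ℚ_{p,∞})[p^∞]` is finite at every prime `p` of potentially good reduction — the named fact `imai1975_finite_fixedPoints_kerSubgroup_inf_decomp_of_padicValRat_j_nonneg` holds

Declarations of this Part (verbatim port; each keeps its own docstring and citation): `noStableDivisibleLine_of_eq'`, `finite_fixedPoints_kerSubgroup_inf_decomp_two`, `finite_fixedPoints_kerSubgroup_inf_decomp`, `imai1975_finite_fixedPoints_kerSubgroup_inf_decomp_of_padicValRat_j_nonneg_holds`.

Reference keys (see `references.bib` and the declarations' citations): [Imai1975], [Serre1967GroupesPDivisibles], [GreenbergLNM1716], [SilvermanAEC2009].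
-/

section Part12

open scoped _root_.Classical _root_.NumberField
open _root_.Function _root_.Field _root_.NumberField _root_.IsDedekindDomain _root_.WeierstrassCurve
open Literature.NumberTheory.EllipticCurves Literature.NumberTheory.EllipticCurves.GreenbergSelmer
open Literature.NumberTheory.GaloisRepresentations
open Literature.NumberTheory.EllipticCurves.IwasawaTowerTorsion

universe u

namespace Literature.NumberTheory.EllipticCurves.IwasawaTowerTorsion.FiniteOrdinary

/-- Transport of the «no stable divisible line» statement along an EQUALITY of Weierstrass curves (for `W.baseChange ℚ = W`; the
g31 file keeps its copy private). [cite: Imai1975, Theorem (p. 12)] -/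
theorem noStableDivisibleLine_of_eq' {K : Type} [Field K] [NumberField K] {E E' : WeierstrassCurve K}
    (h : E = E') (p : ℕ) (𝔭 : HeightOneSpectrum (𝓞 K))
    (hE : ∀ N : AddSubgroup (E.geomPrimaryTorsion p),
      (∀ d ∈ decomp 𝔭, ∀ c ∈ N, d • c ∈ N) → (∀ c ∈ N, ∃ c' ∈ N, p • c' = c) →
      Set.ncard {c : E.geomPrimaryTorsion p | c ∈ N ∧ p • c = 0} ≤ p → N = ⊥) :
    ∀ N : AddSubgroup (E'.geomPrimaryTorsion p),
      (∀ d ∈ decomp 𝔭, ∀ c ∈ N, d • c ∈ N) → (∀ c ∈ N, ∃ c' ∈ N, p • c' = c) →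
      Set.ncard {c : E'.geomPrimaryTorsion p | c ∈ N ∧ p • c = 0} ≤ p → N = ⊥ := by
  subst h
  exact hE

/-- **Imai's finiteness at `p = 2`** (`0 ≤ ord_2 j(W)`, `κ` the cyclotomic `ℤ_2`-extension, `v` the place at `2`): on the potentially
supersingular rows no `D_v`-stable divisible line exists at all (Serre 1967 Prop. 8, tree theorem, `p = 2` included); on the potentially
ordinary rows none is fixed by the tower group (FILE 3, parity-free); and the tower group moves a `4`-torsion point
(`exists_primaryTorsion_not_fixed_rat_two`). [cite: Imai1975, Theorem (p. 12)] [cite: Serre1967GroupesPDivisibles, §5 Prop. 8]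
[cite: GreenbergLNM1716, §3 Lemma 3.3 (p. 87)] -/
theorem finite_fixedPoints_kerSubgroup_inf_decomp_two (W : WeierstrassCurve ℚ) [W.IsElliptic] (p : ℕ) [Fact p.Prime]
    (hp2 : p = 2) (hj : 0 ≤ padicValRat p W.j) (κ : ZpExtension ℚ p) (hκ : κ.IsCyclotomic) (v : HeightOneSpectrum (𝓞 ℚ))
    (hv : ((Rat.HeightOneSpectrum.primesEquiv v : Nat.Primes) : ℕ) = p) :
    Finite (FixedPoints.addSubgroup ↥(κ.kerSubgroup ⊓ decomp v) (W.geomPrimaryTorsion p)) := by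
  have hpr : p.Prime := Fact.out
  have hpv : ((p : ℕ) : 𝓞 ℚ) ∈ v.asIdeal :=
    (natCast_mem_asIdeal_iff_eq_primesEquiv_symm v hpr).mpr ((Equiv.eq_symm_apply _).mpr (Subtype.ext hv))
  have hmove := exists_primaryTorsion_not_fixed_rat_two W p hp2 κ hκ v hv
  have hfin : (FixedPoints.addSubgroup ↥(decomp v ⊓ κ.kerSubgroup) (W.geomPrimaryTorsion p) :
      Set (W.geomPrimaryTorsion p)).Finite := by
    by_cases hss : ∀ (F : Type) [Field F] [NumberField F] (w : HeightOneSpectrum (𝓞 F)),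
        ((p : ℕ) : 𝓞 F) ∈ w.asIdeal → (W.baseChange F).HasGoodReductionAt w → ¬ (W.baseChange F).HasUnitRootAt w
    · have hline := noStableDivisibleLine_of_eq' (Finite.baseChange_rat_eq W) p v
        (Serre1967.noStableDivisibleLine_of_potentiallySupersingular_holds W p hj hss ℚ v hpv)
      exact Literature.NumberTheory.EllipticCurves.IwasawaTowerTorsion.WeierstrassCurve.localTowerTorsionFiniteAt_of_noFixedStableDivisibleLine' W p κ v
        (fun N hst hdiv hcard _ ↦ hline N hst hdiv hcard) hmove
    · push Not at hss
      obtain ⟨F, _, _, w, hw, hgood, hunit⟩ := hss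
      exact Literature.NumberTheory.EllipticCurves.IwasawaTowerTorsion.WeierstrassCurve.localTowerTorsionFiniteAt_of_noFixedStableDivisibleLine' W p κ v
        (fun N _ hNdiv _ hNfix ↦
          eq_bot_of_divisible_of_fixed_of_potentiallyOrdinary W p w hw hgood hunit κ hκ v hpv N hNdiv hNfix) hmove
  rw [inf_comm]
  exact hfin.to_subtype

/-- **Imai's finiteness `W(ℚ_{p,∞})[p^∞] < ∞` at EVERY prime of potentially good reduction** (`0 ≤ ord_p j(W)`, `κ` cyclotomic, `v`
the place at `p`): `p = 2` by `finite_fixedPoints_kerSubgroup_inf_decomp_two`, odd `p` by FILE 3.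
[cite: Imai1975, Theorem (p. 12)] [cite: Serre1967GroupesPDivisibles, §5 Prop. 8] [cite: GreenbergLNM1716, §1 p. 62, §3 Lemma 3.3 (p. 87)] -/
theorem finite_fixedPoints_kerSubgroup_inf_decomp (W : WeierstrassCurve ℚ) [W.IsElliptic] (p : ℕ) [Fact p.Prime]
    (hj : 0 ≤ padicValRat p W.j) (κ : ZpExtension ℚ p) (hκ : κ.IsCyclotomic) (v : HeightOneSpectrum (𝓞 ℚ))
    (hv : ((Rat.HeightOneSpectrum.primesEquiv v : Nat.Primes) : ℕ) = p) :
    Finite (FixedPoints.addSubgroup ↥(κ.kerSubgroup ⊓ decomp v) (W.geomPrimaryTorsion p)) := by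
  by_cases hp2 : p = 2
  · exact finite_fixedPoints_kerSubgroup_inf_decomp_two W p hp2 hj κ hκ v hv
  · exact finite_fixedPoints_kerSubgroup_inf_decomp_of_padicValRat_j_nonneg W p hp2 hj κ hκ v hv

/-- **IMAI 1975 (the tree's named fact `imai1975_finite_fixedPoints_kerSubgroup_inf_decomp_of_padicValRat_j_nonneg`), PROVED — type
VERBATIM the Literature `def`.**  For every elliptic curve `W/ℚ`, every prime `p` with `0 ≤ ord_p j(W)`, the cyclotomic
`ℤ_p`-extension `κ` of `ℚ` and the place `v` of `ℚ` at `p`, the points of `W(ℚ̄)[p^∞]` fixed by `ker κ ⊓ D_v` — `W(ℚ_{p,∞})[p^∞]` —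
form a finite group. [cite: Imai1975, Theorem (p. 12)] [cite: Serre1967GroupesPDivisibles, §5 Prop. 8]
[cite: GreenbergLNM1716, §1 p. 62, §2 p. 70, §3 Lemma 3.3 (p. 87)] [cite: SilvermanAEC2009, Prop. III.8.1 and Prop. VII.5.5] -/
theorem _root_.Literature.NumberTheory.EllipticCurves.imai1975_finite_fixedPoints_kerSubgroup_inf_decomp_of_padicValRat_j_nonneg_holds :
    Literature.NumberTheory.EllipticCurves.imai1975_finite_fixedPoints_kerSubgroup_inf_decomp_of_padicValRat_j_nonneg := by
  intro W _ p _ κ v hj hκ hv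
  exact finite_fixedPoints_kerSubgroup_inf_decomp W p hj κ hκ v hv

end Literature.NumberTheory.EllipticCurves.IwasawaTowerTorsion.FiniteOrdinary

end Part12

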